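import Literature.Computability.AlgebraicComplexity.ABV17SingularLocusBound
import Literature.Computability.AlgebraicComplexity.GeneralisedGrenetMatrix
import HarnessLib

/-!
# Alper–Bogart–Velasco 2017, Thm. 1.8: `dc(x y² + y t² + z³) = 5` — proofs (lower bound)

Topic `Literature/Computability/AlgebraicComplexity` (cell val-lit, row ABV17-A, discharge duty).
Companion of `ABV17SingularLocusBound.lean`, which types J. Alper, T. Bogart, M. Velasco, *A lower
bound for the determinantal complexity of a hypersurface*, Found. Comput. Math. 17 (2017) 829–836 =
arXiv:1505.02205 (HELD as `paper:arxiv-1505.02205`; locators `pNNNN.txt:Lnn` below refer to that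
materialisation) and states Thm. 1.8 (`dc(x y² + y t² + z³) = 5` over a field of characteristic
`0`) as the NAMED FACT `alperBogartVelasco2017_thm_1_8`, with the upper bound `≤ 5` PROVED there
(`determinantalComplexity_abvCubic_le_five`, the printed `5 × 5` matrix). This file PROVES the
lower bound `dc > 4` and the discharge `alperBogartVelasco2017_thm_1_8_holds`; everything here
is a THEOREM (no new facts, D-0026). Honest framing: kernel-checked literature on the determinantal
complexity of one explicit cubic surface; VP ≠ VNP is NOT proved and nothing here bears on it.

## Method: pencils and points

An affine determinantal expression `B` (entries of total degree `≤ 1`, `det B = c·f`) is handled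
through its evaluations `B(v) = B(0) + Σ_w v_w B_w` (`LRPencil.map_eval_eq`; `B(0) = constPart B`,
`B_w = coeffMat B w` the coefficient matrix of the variable `x_w`, `x, y, z, t = x₀, x₁, x₂, x₃`):
`det (J + Σ_w v_w Z_w) = c · f(v)` for all points `v ∈ K⁴` (`det_pencil_of_det_eq`). All the
normalisations of the printed proof ("replace `L` by `P L P⁻¹`", "by its transpose", …) are then
two-sided multiplications / transpositions / reindexings of the pencil `(J, Z)`, and all the
"`f` vanishes on the subspace …" steps are pointwise. Coefficients of the polynomial identities are
extracted by evaluating at `0, ±1, ±2` (`coeff_eq_zero_of_forall`, characteristic `0`).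

## Contents of this file (all PROVED)

* `uniqueLine`, `coeff_zero_of_vanish`, `coeff_zero_of_vanish_two` — **the line `y = z = 0` is
  the unique line on the surface** (p0006.txt:L4, L17, L19), pointwise: if the cone over the surface
  vanishes on a plane of `K⁴` then that plane is `{y = z = 0}`; hence linear forms cutting out such
  a plane lie in `⟨y, z⟩` (and two of them span it).
* `three_false`, `three_false_affine`, `not_hasDetRepr_abvCubic_three` — **`dc(x y² + y t² + z³) > 3`**:
  no `3 × 3` affine (equivalently, by taking the cubic part, linear) determinantal expression of
  `c·f`, `c ≠ 0`. ABV take this from Brundu–Logar 1998 (p0004.txt:L3: "it was shown in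
  [brundu-logar] that … `dc(f) > 3`"; p0006.txt:L2); it is PROVED here from scratch by a case
  analysis on the rank `r'` of the `x`-coefficient matrix `Z_x` (`Matrix.exists_rank_normal_form`):
  `r' = 0` (`f` depends on `x`), `r' = 3` (`f(e_x) = 0`), `r' = 2` (the gradient of `f` vanishes at
  the singular point `e_x`, forcing a zero entry; the last row and column then cut out planes of
  the surface, so lie in `⟨y, z⟩` by the unique line, and `det` is affine along `(0,1,0,s)` while
  `f = s²`), `r' = 1` (`x` only at `(0,0)`; the complementary `2 × 2` block of linear forms has
  determinant `y²`, its `z`- and `t`-parts are traceless, singular and orthogonal, hence have a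
  common left kernel vector; after the induced normalisations the `y = 0` slice forces three entries
  into `⟨y, z⟩` — `t_coeff_eq_zero_of_prod_eq` — and the monomial `y t²` can no longer occur).
  This replaces the citation of Brundu–Logar by a kernel-checked argument; it is also the content of
  the case `r = 1` of ABV's own analysis ("the degree `3` component … gives a determinantal
  expression of `f` of size `3`", p0006.txt:L2).
* Tools: pencil algebra (`mul_pencil_mul`, `transpose_pencil`, `submatrix_pencil`,
  `det_pencil_of_det_eq`), the rank normal form repackaged for `Fin m`
  (`exists_mul_mul_eq_fromBlocks`), `det_eq_of_forall_det_add_smul` (top coefficient of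
  `s ↦ det (J + s N)` via `Polynomial.coeff_det_X_add_C_card`).

* The `4 × 4` analysis (ABV p0006.txt:L1–L47, ranks `r = 0, …, 4` of `L(0)`):
  `four_false_of_rank_zero` / `_four` (homogeneity), `four_false_of_rank_one` (the cubic part is
  a `3 × 3` linear determinantal expression — `three_false`), `four_false_of_rank_two` (the
  quadratic part `Z₂₂Z₃₃ - Z₂₃Z₃₂ = 0` as products of linear forms —
  `exists_eq_smul_or_of_dotProduct_mul` — then `_rel` / `_col` / `_nf`: unique line twice and the
  evaluation along `(0,1,0,s)`), `four_false_of_rank_three` (`Z₃₃ = 0`, `Σ_j Z_{3j}Z_{j3} = 0`;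
  `four_three_sing`: common zeros of the six forms are singular points of the cone, via
  `det L(v + s u) = s² det B(s)`; isotropy bound `finrank_add_one_le_card_of_isotropic` from
  `AlperBogartVelascoIsotropy.lean`; hence the forms are `x`-free, `four_three_col_tcoeff` makes the
  row or column forms independent, `four_false_of_rank_three_colbasis` conjugates the column forms
  to `(z, y, t)`, `four_false_of_rank_three_col` derives the antisymmetric shape
  `(αt + βy, -βz + γt, -γy - αz)` of the row forms and `α = γ = 0` from the kernel line
  `(s, -α, γ, β)`, and `four_false_of_rank_three_nf` closes the sub-case `α = γ = 0`).
* `four_false_affine` (rank dispatch via `Matrix.exists_rank_normal_form`),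
  `not_hasDetRepr_abvCubic_four` (**`dc > 4`**), `five_le_determinantalComplexity_abvCubic`,
  `determinantalComplexity_abvCubic`, and the discharge
  **`alperBogartVelasco2017_thm_1_8_holds : alperBogartVelasco2017_thm_1_8`**.

NOTE on the printed case `r = 3` (for the referees): with ABV's normalisation `(Z₂₁, Z₃₁, Z₄₁) = (z, y, t)`,
`(Z₁₂, Z₁₃, Z₁₄) = (αt + βy, -βz + γt, -γy - αz)`, the printed sentence "these [six] equations are
inconsistent unless `α = 0` and `γ ≠ 0`" (p0006.txt:L47) does not hold in the sub-case
`α = γ = 0, β ≠ 0` (the six equations are solved by `X₂₃ = 1/β, X₂₄ = X₃₂ = X₃₄ = 0, X₂₂ = X₃₃`);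
the top row of `L` vanishes on the line through `(z, y, t) = (γ, -α, β)`, which forces `α = γ = 0`
in ALL cases, and the remaining sub-case is excluded only by the degree-`4` part of `det L`
(coefficients of `z t³` and `z² t²`). The theorem is unaffected; the formal proof follows this
corrected route (`four_false_of_rank_three_col`, `four_false_of_rank_three_nf`).

## References

* [AlperBogartVelasco2017] J. Alper, T. Bogart, M. Velasco, Found. Comput. Math. 17 (2017)
  829–836, doi:10.1007/s10208-015-9300-x, arXiv:1505.02205 — Thm. 1.8 and its proof (§3).
* [BrunduLogar1998] M. Brundu, A. Logar, *Parametrization of the orbits of cubic surfaces*,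
  Transform. Groups 3 (1998) 209–239 — `dc(x y² + y t² + z³) > 3`, as cited by ABV (re-proved here).
-/

noncomputable section

open Matrix MvPolynomial Finset Module

namespace Literature.Computability.AlgebraicComplexity

namespace AlperBogartVelasco

/-! ### The unique line `y = z = 0` on the cubic surface (pointwise form) -/

section UniqueLine

variable {K : Type*} [Field K] [CharZero K]

/-- **The line `y = z = 0` is the only plane of `K⁴` on which the cone over ABV's cubic surface
`x y² + y t² + z³` vanishes**, pointwise form: if `f` vanishes on a subspace `W` of dimension `≥ 2`
then every vector of `W` has `y = z = 0` (ABV p0006.txt:L4: "`y = z = 0` is the unique line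
contained in this cubic surface"). [cite: AlperBogartVelasco2017, proof of Thm. 1.8] -/
theorem uniqueLine {W : Submodule K (Fin 4 → K)} (hW : 2 ≤ finrank K W)
    (hf : ∀ w ∈ W, w 0 * w 1 ^ 2 + w 1 * w 3 ^ 2 + w 2 ^ 3 = 0) :
    ∀ w ∈ W, w 1 = 0 ∧ w 2 = 0 := by
  have h1 : ∀ w ∈ W, w 1 = 0 := by
    by_contra hcon
    push Not at hcon
    obtain ⟨w₁, hw₁, hw₁1⟩ := hcon
    set u : Fin 4 → K := (w₁ 1)⁻¹ • w₁ with hu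
    have huW : u ∈ W := W.smul_mem _ hw₁
    have hu1 : u 1 = 1 := by simp [hu, hw₁1]
    have hnot : ¬ (W ≤ K ∙ u) := by
      intro hle
      have h := Submodule.finrank_mono hle
      have h' : finrank K (K ∙ u) ≤ 1 := by
        refine (finrank_span_le_card ({u} : Set (Fin 4 → K))).trans ?_
        simp
      omega
    obtain ⟨w₂, hw₂W, hw₂⟩ := SetLike.not_le_iff_exists.1 hnot
    set w' : Fin 4 → K := w₂ - (w₂ 1) • u with hw'
    have hw'W : w' ∈ W := W.sub_mem hw₂W (W.smul_mem _ huW)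
    have hw'1 : w' 1 = 0 := by simp [hw', hu1]
    have hw'ne : w' ≠ 0 := by
      intro h0
      apply hw₂
      rw [Submodule.mem_span_singleton]
      refine ⟨w₂ 1, ?_⟩
      rw [hw', sub_eq_zero] at h0
      exact h0.symm
    have key : ∀ a b : K, (a * u 0 + b * w' 0) * (a * u 1 + b * w' 1) ^ 2 +
        (a * u 1 + b * w' 1) * (a * u 3 + b * w' 3) ^ 2 + (a * u 2 + b * w' 2) ^ 3 = 0 := by
      intro a b
      have h := hf _ (W.add_mem (W.smul_mem a huW) (W.smul_mem b hw'W))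
      simpa only [Pi.add_apply, Pi.smul_apply, smul_eq_mul] using h
    have h2 : w' 2 = 0 := by
      have h := key 0 1
      rw [hw'1] at h
      have : w' 2 ^ 3 = 0 := by linear_combination h
      exact pow_eq_zero_iff (n := 3) (by norm_num) |>.1 this
    have g0 := key 1 0
    have g1 := key 1 1
    have g2 := key 1 (-1)
    rw [hu1, hw'1, h2] at g0 g1 g2
    have ht : w' 3 = 0 := by
      have h : (2 : K) * w' 3 ^ 2 = 0 := by linear_combination g1 + g2 - 2 * g0
      have h' : w' 3 ^ 2 = 0 := by
        rcases mul_eq_zero.1 h with h | h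
        · exact absurd h two_ne_zero
        · exact h
      exact pow_eq_zero_iff (n := 2) (by norm_num) |>.1 h'
    have hx : w' 0 = 0 := by
      rw [ht] at g1
      linear_combination g1 - g0
    apply hw'ne
    funext i
    fin_cases i
    · exact hx
    · exact hw'1
    · exact h2
    · exact ht
  intro w hw
  refine ⟨h1 w hw, ?_⟩
  have h := hf w hw
  rw [h1 w hw] at h
  have h' : w 2 ^ 3 = 0 := by linear_combination h
  exact pow_eq_zero_iff (n := 3) (by norm_num) |>.1 h'

omit [CharZero K] in
/-- If every vector of a subspace `W ⊆ K⁴` of dimension `≥ 2` has `y = z = 0`, then `W` is the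
plane `y = z = 0`: it contains `e_x` and `e_t`. [folklore] -/
private theorem single_mem_of_forall_eq_zero {W : Submodule K (Fin 4 → K)} (hW : 2 ≤ finrank K W)
    (h : ∀ w ∈ W, w 1 = 0 ∧ w 2 = 0) :
    (Pi.single 0 1 : Fin 4 → K) ∈ W ∧ (Pi.single 3 1 : Fin 4 → K) ∈ W := by
  let π : W →ₗ[K] (Fin 2 → K) :=
    { toFun := fun w => ![(w : Fin 4 → K) 0, (w : Fin 4 → K) 3]
      map_add' := fun w w' => by
        ext i; fin_cases i <;> simp
      map_smul' := fun r w => by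
        ext i; fin_cases i <;> simp }
  have hπ : ∀ w : W, π w 0 = (w : Fin 4 → K) 0 ∧ π w 1 = (w : Fin 4 → K) 3 := fun w => by
    simp [π]
  have hinj : Function.Injective π := by
    intro w w' hww'
    apply Subtype.ext
    funext i
    have h0 : (w : Fin 4 → K) 0 = (w' : Fin 4 → K) 0 := by
      rw [← (hπ w).1, ← (hπ w').1, hww']
    have h3 : (w : Fin 4 → K) 3 = (w' : Fin 4 → K) 3 := by
      rw [← (hπ w).2, ← (hπ w').2, hww']
    obtain ⟨hw1, hw2⟩ := h w.1 w.2
    obtain ⟨hw'1, hw'2⟩ := h w'.1 w'.2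
    fin_cases i
    · exact h0
    · exact hw1.trans hw'1.symm
    · exact hw2.trans hw'2.symm
    · exact h3
  have hle : finrank K W ≤ 2 := by
    have := LinearMap.finrank_le_finrank_of_injective hinj
    simpa using this
  have heq : finrank K W = finrank K (Fin 2 → K) := by
    simp only [finrank_fintype_fun_eq_card, Fintype.card_fin]
    omega
  have hsurj : Function.Surjective π :=
    (LinearMap.injective_iff_surjective_of_finrank_eq_finrank heq).1 hinj
  have key : ∀ (c : Fin 2 → K), ∃ w ∈ W, (w 0 = c 0 ∧ w 3 = c 1) ∧ w 1 = 0 ∧ w 2 = 0 := by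
    intro c
    obtain ⟨w, hw⟩ := hsurj c
    refine ⟨w, w.2, ⟨?_, ?_⟩, h w.1 w.2⟩
    · rw [← (hπ w).1, hw]
    · rw [← (hπ w).2, hw]
  constructor
  · obtain ⟨w, hwW, ⟨h0, h3⟩, h1, h2⟩ := key ![1, 0]
    have hw : w = Pi.single 0 1 := by
      funext i
      fin_cases i
      · simpa using h0
      · simpa using h1
      · simpa using h2
      · simpa using h3
    exact hw ▸ hwW
  · obtain ⟨w, hwW, ⟨h0, h3⟩, h1, h2⟩ := key ![0, 1]
    have hw : w = Pi.single 3 1 := by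
      funext i
      fin_cases i
      · simpa using h0
      · simpa using h1
      · simpa using h2
      · simpa using h3
    exact hw ▸ hwW

omit [CharZero K] in
/-- Membership in the common kernel of a family of linear forms `v ↦ a_i · v`, as the kernel of
the matrix with rows `a_i`. [folklore] -/
private theorem mem_ker_mulVecLin_of_iff {ι : Type*} [Fintype ι] (a : ι → Fin 4 → K) (v : Fin 4 → K) :
    v ∈ LinearMap.ker (Matrix.of a).mulVecLin ↔ ∀ i, a i ⬝ᵥ v = 0 := by
  rw [LinearMap.mem_ker, Matrix.mulVecLin_apply]
  constructor
  · intro h i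
    have := congrFun h i
    simpa [Matrix.mulVec] using this
  · intro h
    funext i
    simpa [Matrix.mulVec] using h i

omit [CharZero K] in
/-- The common kernel in `K⁴` of a family of linear forms spanning a space of dimension `≤ 2`
has dimension `≥ 2` (rank–nullity). [folklore] -/
private theorem two_le_finrank_ker {ι : Type*} [Fintype ι] (a : ι → Fin 4 → K)
    (ha : (Set.range a).finrank K ≤ 2) :
    2 ≤ finrank K (LinearMap.ker (Matrix.of a).mulVecLin) := by
  have h := LinearMap.finrank_range_add_finrank_ker (Matrix.of a).mulVecLin
  have hr : finrank K (LinearMap.range (Matrix.of a).mulVecLin) = (Matrix.of a).rank := rfl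
  rw [hr, Matrix.rank_eq_finrank_span_row] at h
  have hrow : Set.range (Matrix.of a).row = Set.range a := rfl
  rw [hrow, finrank_fintype_fun_eq_card, Fintype.card_fin] at h
  have : finrank K (Submodule.span K (Set.range a)) ≤ 2 := ha
  omega

/-- **Linear forms cutting out a plane of the cubic surface lie in `⟨y, z⟩`**: if the cone over
ABV's surface vanishes at every common zero of a family of linear forms `ℓ_i = Σ_w a_i(w) x_w` whose
span has dimension `≤ 2`, then every `ℓ_i` has zero `x`- and `t`-coefficient — the common zero
set is exactly the plane `y = z = 0` (ABV p0006.txt:L4, L17, L19: "since `y = z = 0` is the unique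
line contained in this cubic surface"). [cite: AlperBogartVelasco2017, proof of Thm. 1.8] -/
theorem coeff_zero_of_vanish {ι : Type*} [Fintype ι] (a : ι → Fin 4 → K)
    (ha : (Set.range a).finrank K ≤ 2)
    (hf : ∀ v : Fin 4 → K, (∀ i, a i ⬝ᵥ v = 0) → v 0 * v 1 ^ 2 + v 1 * v 3 ^ 2 + v 2 ^ 3 = 0) :
    ∀ i, a i 0 = 0 ∧ a i 3 = 0 := by
  set W := LinearMap.ker (Matrix.of a).mulVecLin with hW
  have h2 : 2 ≤ finrank K W := two_le_finrank_ker a ha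
  have hWf : ∀ w ∈ W, w 0 * w 1 ^ 2 + w 1 * w 3 ^ 2 + w 2 ^ 3 = 0 := fun w hw =>
    hf w ((mem_ker_mulVecLin_of_iff a w).1 hw)
  have hyz := uniqueLine h2 hWf
  obtain ⟨hx, ht⟩ := single_mem_of_forall_eq_zero h2 hyz
  intro i
  have hx' := (mem_ker_mulVecLin_of_iff a _).1 hx i
  have ht' := (mem_ker_mulVecLin_of_iff a _).1 ht i
  rw [dotProduct_single, mul_one] at hx' ht'
  exact ⟨hx', ht'⟩

/-- Two-form version with independence: if the cone vanishes wherever two linear forms `ℓ₁, ℓ₂`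
vanish, then `ℓ₁, ℓ₂ ∈ ⟨y, z⟩` and they are linearly independent there (their `(y, z)`-coefficient
matrix has nonzero determinant) — i.e. `⟨ℓ₁, ℓ₂⟩ = ⟨y, z⟩`. [cite: AlperBogartVelasco2017, proof of Thm. 1.8] -/
theorem coeff_zero_of_vanish_two (a b : Fin 4 → K)
    (hf : ∀ v : Fin 4 → K, a ⬝ᵥ v = 0 → b ⬝ᵥ v = 0 → v 0 * v 1 ^ 2 + v 1 * v 3 ^ 2 + v 2 ^ 3 = 0) :
    (a 0 = 0 ∧ a 3 = 0) ∧ (b 0 = 0 ∧ b 3 = 0) ∧ a 1 * b 2 - a 2 * b 1 ≠ 0 := by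
  have hf' : ∀ v : Fin 4 → K, (∀ i, ![a, b] i ⬝ᵥ v = 0) →
      v 0 * v 1 ^ 2 + v 1 * v 3 ^ 2 + v 2 ^ 3 = 0 := fun v hv =>
    hf v (by simpa using hv 0) (by simpa using hv 1)
  have hrk : (Set.range ![a, b]).finrank K ≤ 2 :=
    (finrank_range_le_card _).trans (by simp)
  have h := coeff_zero_of_vanish ![a, b] hrk hf'
  have ha : a 0 = 0 ∧ a 3 = 0 := by simpa using h 0
  have hb : b 0 = 0 ∧ b 3 = 0 := by simpa using h 1
  refine ⟨ha, hb, fun hdet => ?_⟩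
  have hdot : ∀ (c : Fin 4 → K) (p q r s : K),
      c ⬝ᵥ ![p, q, r, s] = c 0 * p + c 1 * q + c 2 * r + c 3 * s :=
    fun c p q r s => by simp [dotProduct, Fin.sum_univ_four]
  have hF : ∀ p q r s : K, a ⬝ᵥ ![p, q, r, s] = 0 → b ⬝ᵥ ![p, q, r, s] = 0 →
      p * q ^ 2 + q * s ^ 2 + r ^ 3 = 0 := fun p q r s h1 h2 => by
    simpa using hf _ h1 h2
  obtain ⟨ha0, ha3⟩ := ha
  obtain ⟨hb0, hb3⟩ := hb
  -- `a` vanishes: test vectors `(0, a₂, -a₁, 0)` and `(1, a₂, 0, 0)`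
  have ha1 : a 1 = 0 := by
    have hv := hF 0 (a 2) (-a 1) 0
      (by rw [hdot]; ring)
      (by rw [hdot, hb0, hb3]; linear_combination -hdet)
    have h3 : a 1 ^ 3 = 0 := by linear_combination -hv
    exact pow_eq_zero_iff (n := 3) (by norm_num) |>.1 h3
  have ha2 : a 2 = 0 := by
    have hv := hF 1 (a 2) 0 0
      (by rw [hdot, ha0, ha1]; ring)
      (by rw [hdot, hb0]; linear_combination -hdet + b 2 * ha1)
    have h2 : a 2 ^ 2 = 0 := by linear_combination hv
    exact pow_eq_zero_iff (n := 2) (by norm_num) |>.1 h2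
  have hav : ∀ p q r s : K, a ⬝ᵥ ![p, q, r, s] = 0 := fun p q r s => by
    rw [hdot, ha0, ha1, ha2, ha3]; ring
  -- then `b` vanishes likewise
  have hb1 : b 1 = 0 := by
    have hv := hF 0 (b 2) (-b 1) 0 (hav _ _ _ _) (by rw [hdot]; ring)
    have h3 : b 1 ^ 3 = 0 := by linear_combination -hv
    exact pow_eq_zero_iff (n := 3) (by norm_num) |>.1 h3
  have hb2 : b 2 = 0 := by
    have hv := hF 1 (b 2) 0 0 (hav _ _ _ _) (by rw [hdot, hb0, hb1]; ring)
    have h2 : b 2 ^ 2 = 0 := by linear_combination hv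
    exact pow_eq_zero_iff (n := 2) (by norm_num) |>.1 h2
  -- but `f(e_z) = 1`
  have hv := hF 0 0 1 0 (hav _ _ _ _) (by rw [hdot, hb0, hb1, hb2, hb3]; ring)
  norm_num at hv

end UniqueLine

/-! ### Pencils of matrices: evaluation of an affine matrix at a point, and its symmetries -/

section Pencil

variable {K : Type*} [Field K] {n : Type*} [Fintype n] [DecidableEq n]

omit [Fintype n] [DecidableEq n] in
/-- Entries of an evaluated pencil `J + Σ_w v_w Z_w`. [folklore] -/
private theorem pencil_apply (J : Matrix n n K) (Z : Fin 4 → Matrix n n K) (v : Fin 4 → K) (i j : n) :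
    (J + ∑ w, v w • Z w) i j = J i j + (v 0 * Z 0 i j + v 1 * Z 1 i j + v 2 * Z 2 i j + v 3 * Z 3 i j) := by
  simp [Fin.sum_univ_four]

omit [DecidableEq n] in
/-- Two-sided multiplication by constant matrices acts termwise on a pencil. [folklore] -/
private theorem mul_pencil_mul (G H J : Matrix n n K) (Z : Fin 4 → Matrix n n K) (v : Fin 4 → K) :
    G * (J + ∑ w, v w • Z w) * H = G * J * H + ∑ w, v w • (G * Z w * H) := by
  rw [Matrix.mul_add, Matrix.add_mul, Finset.mul_sum, Finset.sum_mul]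
  refine congrArg _ (Finset.sum_congr rfl fun w _ => ?_)
  rw [Matrix.mul_smul, Matrix.smul_mul]

omit [Fintype n] [DecidableEq n] in
/-- Transposition acts termwise on a pencil. [folklore] -/
private theorem transpose_pencil (J : Matrix n n K) (Z : Fin 4 → Matrix n n K) (v : Fin 4 → K) :
    (J + ∑ w, v w • Z w)ᵀ = Jᵀ + ∑ w, v w • (Z w)ᵀ := by
  rw [Matrix.transpose_add, Matrix.transpose_sum]
  refine congrArg _ (Finset.sum_congr rfl fun w _ => ?_)
  rw [Matrix.transpose_smul]

omit [Fintype n] [DecidableEq n] in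
/-- Reindexing acts termwise on a pencil. [folklore] -/
private theorem submatrix_pencil {l : Type*} (J : Matrix n n K) (Z : Fin 4 → Matrix n n K)
    (v : Fin 4 → K) (e : l → n) :
    (J + ∑ w, v w • Z w).submatrix e e = J.submatrix e e + ∑ w, v w • (Z w).submatrix e e := by
  ext i j
  simp [Matrix.sum_apply]

/-- **Evaluation of an affine determinantal expression of `c · (x y² + y t² + z³)` at a point**:
`det (B(0) + Σ_w v_w B_w) = c · f(v)` (`LRPencil.map_eval_eq`). [folklore] -/
private theorem det_pencil_of_det_eq {B : Matrix n n (MvPolynomial (Fin 4) K)}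
    (hB1 : ∀ i j, (B i j).totalDegree ≤ 1) {c : K} (hdet : B.det = C c * abvCubic K)
    (v : Fin 4 → K) :
    (constPart B + ∑ w, v w • LRPencil.coeffMat B w).det =
      c * (v 0 * v 1 ^ 2 + v 1 * v 3 ^ 2 + v 2 ^ 3) := by
  rw [← LRPencil.map_eval_eq B hB1 v]
  have h : (B.map (MvPolynomial.eval v)).det = MvPolynomial.eval v B.det := by
    rw [RingHom.map_det, RingHom.mapMatrix_apply]
  rw [h, hdet, map_mul, eval_C, abvCubic]
  simp

/-- **Rank normal form of a square matrix over a field** (`Matrix.exists_rank_normal_form`),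
repackaged for `Fin m`: `G A H` is the `0/1` block-diagonal matrix with `rank A` ones, along some
reindexing `e : Fin m ≃ Fin (rank A) ⊕ Fin (m - rank A)`. [folklore] -/
private theorem exists_mul_mul_eq_fromBlocks {m : ℕ} (A : Matrix (Fin m) (Fin m) K) :
    ∃ (G H : Matrix (Fin m) (Fin m) K) (e : Fin m ≃ Fin A.rank ⊕ Fin (m - A.rank)),
      IsUnit G.det ∧ IsUnit H.det ∧ G * A * H = (Matrix.fromBlocks 1 0 0 0).submatrix e e := by
  obtain ⟨V, U, e, hV, hU, hVU⟩ := Matrix.exists_rank_normal_form A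
  have hc : Fintype.card (Fin m) - A.rank = m - A.rank := by rw [Fintype.card_fin]
  refine ⟨V, U, e.trans (Equiv.sumCongr (Equiv.refl _) (finCongr hc)),
    (Matrix.isUnit_iff_isUnit_det V).1 hV, (Matrix.isUnit_iff_isUnit_det U).1 hU, ?_⟩
  rw [hVU]
  ext i j
  simp only [Matrix.submatrix_apply, Equiv.trans_apply]
  rcases e i with a | a <;> rcases e j with b | b <;> simp [Matrix.fromBlocks]

end Pencil

/-! ### Vanishing of the coefficients of a polynomial function of degree `≤ 4` -/

section Vandermonde

variable {K : Type*} [Field K] [CharZero K]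

/-- Over a field of characteristic `0`, a polynomial function `a₀ + a₁ s + a₂ s² + a₃ s³ + a₄ s⁴`
vanishing at `s = 0, ±1, ±2` is zero. [folklore] -/
private theorem coeff_eq_zero_of_forall (a₀ a₁ a₂ a₃ a₄ : K)
    (h : ∀ s : K, a₀ + a₁ * s + a₂ * s ^ 2 + a₃ * s ^ 3 + a₄ * s ^ 4 = 0) :
    a₀ = 0 ∧ a₁ = 0 ∧ a₂ = 0 ∧ a₃ = 0 ∧ a₄ = 0 := by
  have h0 := h 0
  have h1 := h 1
  have h2 := h (-1)
  have h3 := h 2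
  have h4 := h (-2)
  have e0 : a₀ = 0 := by linear_combination h0
  have e4 : a₄ = 0 := by
    linear_combination ((h3 + h4) - 4 * (h1 + h2) + 6 * h0) / 24
  have e2 : a₂ = 0 := by
    linear_combination (16 * (h1 + h2) - (h3 + h4) - 30 * h0) / 24
  have e3 : a₃ = 0 := by
    linear_combination ((h3 - h4) - 2 * (h1 - h2)) / 12
  have e1 : a₁ = 0 := by
    linear_combination (8 * (h1 - h2) - (h3 - h4)) / 12
  exact ⟨e0, e1, e2, e3, e4⟩

end Vandermonde

/-! ### No `3 × 3` matrix of linear forms has determinant `c · (x y² + y t² + z³)`, `c ≠ 0`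

This is the input "`dc(f) > 3`" that ABV take from Brundu–Logar (p0004.txt:L3, p0006.txt:L2:
"By [brundu-logar], we know that `dc(f) > 3`"; for a `3 × 3` AFFINE expression the cubic part of
the determinant is the determinant of the linear part, so `dc(f) > 3` is exactly the absence of a
`3 × 3` LINEAR determinantal expression). We prove it directly, in the language of pencils
`Σ_w v_w Z_w` (`Z_w` = coefficient matrix of the variable `x_w`), by the case analysis on the rank
of `Z_x` described in the module docstring. -/

section Three

variable {K : Type*} [Field K]

/-- Evaluation of ABV's cubic at a point. [cite: AlperBogartVelasco2017, Thm. 1.8] -/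
@[simp] theorem eval_abvCubic (v : Fin 4 → K) :
    MvPolynomial.eval v (abvCubic K) = v 0 * v 1 ^ 2 + v 1 * v 3 ^ 2 + v 2 ^ 3 := by
  simp [abvCubic]

/-- A pencil evaluated at a point, written out. [folklore] -/
private theorem sum_smul_four {n : Type*} (Z : Fin 4 → Matrix n n K) (v : Fin 4 → K) :
    ∑ w, v w • Z w = v 0 • Z 0 + v 1 • Z 1 + v 2 • Z 2 + v 3 • Z 3 :=
  Fin.sum_univ_four _

/-- `det (diag(1,1,0) + s N)` expanded in powers of `s`. [folklore] -/
private theorem det_diagonal_one_one_zero_add_smul (N : Matrix (Fin 3) (Fin 3) K) (s : K) :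
    (Matrix.diagonal ![(1 : K), 1, 0] + s • N).det =
      s * N 2 2 + s ^ 2 * (N 0 0 * N 2 2 - N 0 2 * N 2 0 + N 1 1 * N 2 2 - N 1 2 * N 2 1) +
        s ^ 3 * N.det := by
  simp [Matrix.det_fin_three]
  ring

/-- `det (diag(1,0,0) + M)` for a `3 × 3` matrix: linearity in the first row. [folklore] -/
private theorem det_add_smul_diagonal_one_zero_zero (M : Matrix (Fin 3) (Fin 3) K) (s : K) :
    (M + s • Matrix.diagonal ![(1 : K), 0, 0]).det =
      M.det + s * (M 1 1 * M 2 2 - M 1 2 * M 2 1) := by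
  simp [Matrix.det_fin_three]
  ring

/-- Rank `0` of `Z_x` is impossible: `f` depends on `x`. [cite: AlperBogartVelasco2017, proof of Thm. 1.8] -/
theorem three_false_of_rank_zero {Z : Fin 4 → Matrix (Fin 3) (Fin 3) K} {c : K} (hc : c ≠ 0)
    (hP : ∀ v : Fin 4 → K, (∑ w, v w • Z w).det = c * MvPolynomial.eval v (abvCubic K))
    (h0 : Z 0 = 0) : False := by
  have h1 := hP ![1, 1, 0, 0]
  have h2 := hP ![0, 1, 0, 0]
  rw [sum_smul_four, eval_abvCubic] at h1 h2
  simp [h0] at h1 h2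
  exact hc (by rw [← h1, h2])

/-- Rank `3` of `Z_x` is impossible: `f(e_x) = 0`. [cite: AlperBogartVelasco2017, proof of Thm. 1.8] -/
theorem three_false_of_rank_three {Z : Fin 4 → Matrix (Fin 3) (Fin 3) K} {c : K}
    (hP : ∀ v : Fin 4 → K, (∑ w, v w • Z w).det = c * MvPolynomial.eval v (abvCubic K))
    (h0 : Z 0 = 1) : False := by
  have h1 := hP ![1, 0, 0, 0]
  rw [sum_smul_four, eval_abvCubic] at h1
  simp [h0] at h1

/-- In a pencil whose `i`-th row consists of the linear forms `v ↦ a_{ij} · v`, the determinant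
vanishes wherever these forms all vanish. [folklore] -/
private theorem det_pencil_eq_zero_of_row {n : Type*} [Fintype n] [DecidableEq n]
    (Z : Fin 4 → Matrix n n K) (v : Fin 4 → K) (i : n)
    (h : ∀ j, (fun w => Z w i j) ⬝ᵥ v = 0) : (∑ w, v w • Z w).det = 0 := by
  refine Matrix.det_eq_zero_of_row_eq_zero i fun j => ?_
  have := h j
  simp only [dotProduct, Fin.sum_univ_four] at this
  rw [Matrix.sum_apply, Fin.sum_univ_four]
  simp only [Matrix.smul_apply, smul_eq_mul]
  linear_combination this

/-- Column version of `det_pencil_eq_zero_of_row`. [folklore] -/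
private theorem det_pencil_eq_zero_of_col {n : Type*} [Fintype n] [DecidableEq n]
    (Z : Fin 4 → Matrix n n K) (v : Fin 4 → K) (j : n)
    (h : ∀ i, (fun w => Z w i j) ⬝ᵥ v = 0) : (∑ w, v w • Z w).det = 0 := by
  rw [← Matrix.det_transpose, Matrix.transpose_sum]
  simp_rw [Matrix.transpose_smul]
  exact det_pencil_eq_zero_of_row (fun w => (Z w)ᵀ) v j fun i => h i

variable [CharZero K]

/-- Coefficient of `s` in `det(diag(1,1,0) + s N) = c (g₂ s² + g₃ s³)` : `N₂₂ = 0`. [folklore] -/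
private theorem apply_two_two_eq_zero {N : Matrix (Fin 3) (Fin 3) K} {c g₂ g₃ : K}
    (h : ∀ s : K, (Matrix.diagonal ![(1 : K), 1, 0] + s • N).det = c * (g₂ * s ^ 2 + g₃ * s ^ 3)) :
    N 2 2 = 0 := by
  have key := coeff_eq_zero_of_forall 0 (N 2 2)
    (N 0 0 * N 2 2 - N 0 2 * N 2 0 + N 1 1 * N 2 2 - N 1 2 * N 2 1 - c * g₂) (N.det - c * g₃) 0
    (fun s => by
      have h' := h s
      rw [det_diagonal_one_one_zero_add_smul] at h'
      linear_combination h')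
  exact key.2.1

/-- **Rank `2` of `Z_x` is impossible.** With `Z_x = diag(1,1,0)`: the gradient of `f` vanishes at
`e_x`, which forces `(Z_w)₂₂ = 0` for all `w` (coefficient of `s` in `det(Z_x + s Z_w)`); then the
last row and the last column of the pencil are pairs of linear forms on whose common zeros `f`
vanishes, so by the unique-line lemma they lie in `⟨y, z⟩`; evaluating at `(0, 1, 0, s)` the
determinant is affine in `s` while `f = s²`. [cite: AlperBogartVelasco2017, proof of Thm. 1.8] -/
theorem three_false_of_rank_two {Z : Fin 4 → Matrix (Fin 3) (Fin 3) K} {c : K} (hc : c ≠ 0)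
    (hP : ∀ v : Fin 4 → K, (∑ w, v w • Z w).det = c * MvPolynomial.eval v (abvCubic K))
    (h0 : Z 0 = Matrix.diagonal ![(1 : K), 1, 0]) : False := by
  -- (i) `(Z_w)₂₂ = 0` for every `w`
  have h22 : ∀ w, Z w 2 2 = 0 := by
    have hw1 : Z 1 2 2 = 0 := by
      refine apply_two_two_eq_zero (c := c) (g₂ := 1) (g₃ := 0) fun s => ?_
      have h := hP ![1, s, 0, 0]
      rw [sum_smul_four, eval_abvCubic, h0] at h
      simp at h
      rw [h]; ring
    have hw2 : Z 2 2 2 = 0 := by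
      refine apply_two_two_eq_zero (c := c) (g₂ := 0) (g₃ := 1) fun s => ?_
      have h := hP ![1, 0, s, 0]
      rw [sum_smul_four, eval_abvCubic, h0] at h
      simp at h
      rw [h]; ring
    have hw3 : Z 3 2 2 = 0 := by
      refine apply_two_two_eq_zero (c := c) (g₂ := 0) (g₃ := 0) fun s => ?_
      have h := hP ![1, 0, 0, s]
      rw [sum_smul_four, eval_abvCubic, h0] at h
      simp at h
      rw [h]; ring
    intro w
    fin_cases w
    · simp [h0]
    · exact hw1
    · exact hw2
    · exact hw3
  -- (ii) the last row / column forms lie in `⟨y, z⟩`: their `t`-coefficients vanish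
  have hvan : ∀ v : Fin 4 → K, (∑ w, v w • Z w).det = 0 →
      v 0 * v 1 ^ 2 + v 1 * v 3 ^ 2 + v 2 ^ 3 = 0 := by
    intro v hv
    have h := hP v
    rw [hv, eval_abvCubic] at h
    rcases mul_eq_zero.1 h.symm with h | h
    · exact absurd h hc
    · exact h
  have hrow := coeff_zero_of_vanish_two (fun w => Z w 2 0) (fun w => Z w 2 1) fun v h₀ h₁ =>
    hvan v (det_pencil_eq_zero_of_row Z v 2 fun j => by
      fin_cases j
      · exact h₀
      · exact h₁
      · simp [dotProduct, h22])
  have hcol := coeff_zero_of_vanish_two (fun w => Z w 0 2) (fun w => Z w 1 2) fun v h₀ h₁ =>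
    hvan v (det_pencil_eq_zero_of_col Z v 2 fun i => by
      fin_cases i
      · exact h₀
      · exact h₁
      · simp [dotProduct, h22])
  obtain ⟨⟨-, h20⟩, ⟨-, h21⟩, -⟩ := hrow
  obtain ⟨⟨-, h02⟩, ⟨-, h12⟩, -⟩ := hcol
  -- (iii) evaluate at `(0, 1, 0, s)`, `s = 0, 1, 2`
  have hs : ∀ s : K, (Z 1 + s • Z 3).det = c * s ^ 2 := by
    intro s
    have h := hP ![0, 1, 0, s]
    rw [sum_smul_four, eval_abvCubic] at h
    simpa using h
  have e0 := hs 0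
  have e1 := hs 1
  have e2 := hs 2
  rw [Matrix.det_fin_three] at e0 e1 e2
  simp only [Matrix.add_apply, Matrix.smul_apply, smul_eq_mul, h22, h20, h21, h02, h12] at e0 e1 e2
  have : (2 : K) * c = 0 := by linear_combination 2 * e1 - e0 - e2
  rcases mul_eq_zero.1 this with h | h
  · exact two_ne_zero h
  · exact hc h

/-! #### Rank `1` of `Z_x`: the chain of normalisations -/

omit [CharZero K] in
/-- Adding `s e_i` to the point adds `s Z_i` to the pencil. [folklore] -/
private theorem sum_add_single_smul {n : Type*} (Z : Fin 4 → Matrix n n K) (v : Fin 4 → K) (s : K)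
    (i : Fin 4) : ∑ w, (v + s • (Pi.single i 1 : Fin 4 → K)) w • Z w = (∑ w, v w • Z w) + s • Z i := by
  simp only [Pi.add_apply, Pi.smul_apply, smul_eq_mul, add_smul, Finset.sum_add_distrib]
  congr 1
  rw [Finset.sum_eq_single i]
  · simp
  · intro w _ hw
    simp [hw]
  · simp

omit [CharZero K] in
/-- With `Z_x = diag(1,0,0)`: the `(1,2)`-block of the pencil has determinant `c y²` (coefficient of
`s` in `det P(v + s e_x) = c f(v + s e_x)`; ABV: "the degree 3 component … gives a determinantal
expression", here `f = x·y² + (y t² + z³)` is linear in `x`). [cite: AlperBogartVelasco2017, proof of Thm. 1.8] -/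
theorem block_det_eq {Z : Fin 4 → Matrix (Fin 3) (Fin 3) K} {c : K}
    (hP : ∀ v : Fin 4 → K, (∑ w, v w • Z w).det = c * MvPolynomial.eval v (abvCubic K))
    (h0 : Z 0 = Matrix.diagonal ![(1 : K), 0, 0]) (v : Fin 4 → K) :
    (∑ w, v w • Z w) 1 1 * (∑ w, v w • Z w) 2 2 - (∑ w, v w • Z w) 1 2 * (∑ w, v w • Z w) 2 1 =
      c * v 1 ^ 2 := by
  have h1 := hP (v + (1 : K) • (Pi.single 0 1 : Fin 4 → K))
  rw [sum_add_single_smul, h0, det_add_smul_diagonal_one_zero_zero, hP v, eval_abvCubic,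
    eval_abvCubic] at h1
  simp at h1
  linear_combination h1

omit [CharZero K] in
/-- A nonzero vector in the left kernel of a singular `2 × 2` matrix. [folklore] -/
private theorem exists_vecMul_eq_zero_two (S : Matrix (Fin 2) (Fin 2) K)
    (hS : S 0 0 * S 1 1 - S 0 1 * S 1 0 = 0) : ∃ p : Fin 2 → K, p ≠ 0 ∧ p ᵥ* S = 0 := by
  by_cases h1 : S 0 1 = 0 ∧ S 1 1 = 0
  · by_cases h2 : S 0 0 = 0 ∧ S 1 0 = 0
    · refine ⟨![1, 0], by simp, ?_⟩
      ext j; fin_cases j <;> simp [Matrix.vecMul, dotProduct, Fin.sum_univ_two, h1.1, h1.2, h2.1, h2.2]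
    · refine ⟨![S 1 0, -S 0 0], ?_, ?_⟩
      · intro h
        have e0 := congrFun h 0
        have e1 := congrFun h 1
        simp at e0 e1
        exact h2 ⟨e1, e0⟩
      · ext j; fin_cases j
        · simp [Matrix.vecMul, dotProduct, Fin.sum_univ_two]; ring
        · simp [Matrix.vecMul, dotProduct, Fin.sum_univ_two, h1.1, h1.2]
  · refine ⟨![S 1 1, -S 0 1], ?_, ?_⟩
    · intro h
      have e0 := congrFun h 0
      have e1 := congrFun h 1
      simp at e0 e1
      exact h1 ⟨e1, e0⟩
    · ext j; fin_cases j
      · simp [Matrix.vecMul, dotProduct, Fin.sum_univ_two]; linear_combination hS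
      · simp [Matrix.vecMul, dotProduct, Fin.sum_univ_two]; ring

/-- **Two traceless singular `2 × 2` matrices which are orthogonal for the polarised determinant
have a common left-kernel vector** (they span a totally isotropic subspace of the split `3`-space
`(sl₂, det)`, hence are proportional). Entrywise statement. [folklore] -/
private theorem exists_common_vecMul_eq_zero (M N : Matrix (Fin 2) (Fin 2) K)
    (hMt : M 0 0 + M 1 1 = 0) (hMd : M 0 0 * M 1 1 - M 0 1 * M 1 0 = 0)
    (hNt : N 0 0 + N 1 1 = 0) (hNd : N 0 0 * N 1 1 - N 0 1 * N 1 0 = 0)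
    (hMN : M 1 1 * N 0 0 + M 0 0 * N 1 1 - M 0 1 * N 1 0 - M 1 0 * N 0 1 = 0) :
    ∃ p : Fin 2 → K, p ≠ 0 ∧ p ᵥ* M = 0 ∧ p ᵥ* N = 0 := by
  -- traceless parametrisation `M = [[a, b], [c, -a]]`, `N = [[a', b'], [c', -a']]`
  have hM11 : M 1 1 = -M 0 0 := by linear_combination hMt
  have hN11 : N 1 1 = -N 0 0 := by linear_combination hNt
  have H1 : M 0 0 ^ 2 + M 0 1 * M 1 0 = 0 := by
    rw [hM11] at hMd; linear_combination -hMd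
  have H1' : N 0 0 ^ 2 + N 0 1 * N 1 0 = 0 := by
    rw [hN11] at hNd; linear_combination -hNd
  have Hβ : 2 * M 0 0 * N 0 0 + M 0 1 * N 1 0 + M 1 0 * N 0 1 = 0 := by
    rw [hM11, hN11] at hMN; linear_combination -hMN
  -- `(b a' - a b')² = 0`
  have hpar : M 0 1 * N 0 0 - M 0 0 * N 0 1 = 0 := by
    have hsq : (M 0 1 * N 0 0 - M 0 0 * N 0 1) ^ 2 = 0 := by
      linear_combination M 0 1 ^ 2 * H1' - M 0 1 * N 0 1 * Hβ + N 0 1 ^ 2 * H1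
    exact pow_eq_zero_iff (n := 2) (by norm_num) |>.1 hsq
  by_cases hM0 : M = 0
  · obtain ⟨p, hp, hpN⟩ := exists_vecMul_eq_zero_two N hNd
    exact ⟨p, hp, by rw [hM0, Matrix.vecMul_zero], hpN⟩
  by_cases hb : M 0 1 = 0
  · -- then `a = 0`, `M = [[0,0],[c,0]]` with `c ≠ 0`, and `b' = 0`, `a' = 0`
    have ha : M 0 0 = 0 := by
      rw [hb, zero_mul, add_zero] at H1
      exact pow_eq_zero_iff (n := 2) (by norm_num) |>.1 H1
    have hc : M 1 0 ≠ 0 := by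
      intro hc
      apply hM0
      rw [Matrix.eta_fin_two M, hM11, ha, hb, hc, neg_zero]
      ext i j; fin_cases i <;> fin_cases j <;> rfl
    have hb' : N 0 1 = 0 := by
      have h : M 1 0 * N 0 1 = 0 := by
        rw [ha, hb] at Hβ; linear_combination Hβ
      rcases mul_eq_zero.1 h with h | h
      · exact absurd h hc
      · exact h
    have ha' : N 0 0 = 0 := by
      rw [hb', zero_mul, add_zero] at H1'
      exact pow_eq_zero_iff (n := 2) (by norm_num) |>.1 H1'
    refine ⟨![1, 0], by simp, ?_, ?_⟩
    · ext j; fin_cases j <;> simp [Matrix.vecMul, dotProduct, Fin.sum_univ_two, ha, hb]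
    · ext j; fin_cases j <;> simp [Matrix.vecMul, dotProduct, Fin.sum_univ_two, ha', hb']
  · -- `b ≠ 0`: `p = (-c, a)` hmm: left kernel of `M`: `p = (M 1 1, -M 0 1)`
    have key : M 0 0 * N 0 0 + M 1 0 * N 0 1 = 0 := by
      have h : M 0 1 * (M 0 0 * N 0 0 + M 1 0 * N 0 1) = 0 := by
        linear_combination M 0 0 * hpar + N 0 1 * H1
      rcases mul_eq_zero.1 h with h | h
      · exact absurd h hb
      · exact h
    refine ⟨![M 1 1, -M 0 1], ?_, ?_, ?_⟩
    · intro h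
      have e1 := congrFun h 1
      simp at e1
      exact hb e1
    · ext j; fin_cases j
      · simp [Matrix.vecMul, dotProduct, Fin.sum_univ_two]; linear_combination hMd
      · simp [Matrix.vecMul, dotProduct, Fin.sum_univ_two]; ring
    · ext j; fin_cases j
      · simp [Matrix.vecMul, dotProduct, Fin.sum_univ_two]
        rw [hM11]; linear_combination key - Hβ
      · simp [Matrix.vecMul, dotProduct, Fin.sum_univ_two]
        rw [hM11, hN11]; linear_combination hpar

/-- **Three linear forms in `z, t` with product `c z³`, `c ≠ 0`, are multiples of `z`.** [folklore] -/
private theorem t_coeff_eq_zero_of_prod_eq (a₁ b₁ a₂ b₂ a₃ b₃ c : K) (hc : c ≠ 0)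
    (h : ∀ z t : K, (a₁ * z + b₁ * t) * (a₂ * z + b₂ * t) * (a₃ * z + b₃ * t) = c * z ^ 3) :
    b₁ = 0 ∧ b₂ = 0 ∧ b₃ = 0 := by
  have ha : a₁ * a₂ * a₃ = c := by linear_combination h 1 0
  have ha1 : a₁ ≠ 0 := fun h0 => hc (by rw [← ha, h0]; ring)
  have ha2 : a₂ ≠ 0 := fun h0 => hc (by rw [← ha, h0]; ring)
  have ha3 : a₃ ≠ 0 := fun h0 => hc (by rw [← ha, h0]; ring)
  have key := coeff_eq_zero_of_forall 0
    (a₁ * a₂ * b₃ + a₁ * b₂ * a₃ + b₁ * a₂ * a₃) (a₁ * b₂ * b₃ + b₁ * a₂ * b₃ + b₁ * b₂ * a₃)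
    (b₁ * b₂ * b₃) 0 (fun s => by linear_combination h 1 s - ha)
  obtain ⟨-, e1, e2, e3, -⟩ := key
  rcases mul_eq_zero.1 e3 with h12 | hb3
  · rcases mul_eq_zero.1 h12 with hb1 | hb2
    · rw [hb1] at e1 e2
      have hb : b₂ * b₃ = 0 := by
        have : a₁ * (b₂ * b₃) = 0 := by linear_combination e2
        exact (mul_eq_zero.1 this).resolve_left ha1
      rcases mul_eq_zero.1 hb with hb2 | hb3
      · refine ⟨hb1, hb2, ?_⟩
        rw [hb2] at e1
        have : a₁ * a₂ * b₃ = 0 := by linear_combination e1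
        exact (mul_eq_zero.1 this).resolve_left (mul_ne_zero ha1 ha2)
      · refine ⟨hb1, ?_, hb3⟩
        rw [hb3] at e1
        have : a₁ * a₃ * b₂ = 0 := by linear_combination e1
        exact (mul_eq_zero.1 this).resolve_left (mul_ne_zero ha1 ha3)
    · rw [hb2] at e1 e2
      have hb : b₁ * b₃ = 0 := by
        have : a₂ * (b₁ * b₃) = 0 := by linear_combination e2
        exact (mul_eq_zero.1 this).resolve_left ha2
      rcases mul_eq_zero.1 hb with hb1 | hb3
      · refine ⟨hb1, hb2, ?_⟩
        rw [hb1] at e1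
        have : a₁ * a₂ * b₃ = 0 := by linear_combination e1
        exact (mul_eq_zero.1 this).resolve_left (mul_ne_zero ha1 ha2)
      · refine ⟨?_, hb2, hb3⟩
        rw [hb3] at e1
        have : a₂ * a₃ * b₁ = 0 := by linear_combination e1
        exact (mul_eq_zero.1 this).resolve_left (mul_ne_zero ha2 ha3)
  · rw [hb3] at e1 e2
    have hb : b₁ * b₂ = 0 := by
      have : a₃ * (b₁ * b₂) = 0 := by linear_combination e2
      exact (mul_eq_zero.1 this).resolve_left ha3
    rcases mul_eq_zero.1 hb with hb1 | hb2
    · refine ⟨hb1, ?_, hb3⟩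
      rw [hb1] at e1
      have : a₁ * a₃ * b₂ = 0 := by linear_combination e1
      exact (mul_eq_zero.1 this).resolve_left (mul_ne_zero ha1 ha3)
    · refine ⟨?_, hb2, hb3⟩
      rw [hb2] at e1
      have : a₂ * a₃ * b₁ = 0 := by linear_combination e1
      exact (mul_eq_zero.1 this).resolve_left (mul_ne_zero ha2 ha3)

/-- **Final normal form for rank `1`** (`x` only at `(0,0)`, row `1` of the pencil `= (m₁₀, 0, y)`),
impossible: the `y = 0` slice forces `m₁₀, m₀₁, m₂₂ ∈ ⟨y, z⟩`, after which the monomial `y t²`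
cannot occur in the determinant. [cite: AlperBogartVelasco2017, proof of Thm. 1.8] -/
theorem three_false_of_rank_one_nf {Z : Fin 4 → Matrix (Fin 3) (Fin 3) K}
    (hP : ∀ v : Fin 4 → K, (∑ w, v w • Z w).det = 1 * MvPolynomial.eval v (abvCubic K))
    (h0 : Z 0 = Matrix.diagonal ![(1 : K), 0, 0])
    (h11 : ∀ w, Z w 1 1 = 0) (h12 : ∀ w, Z w 1 2 = if w = 1 then 1 else 0) : False := by
  -- `(Z_w)₂₁ = -[w = 1]`
  have h21 : ∀ w, Z w 2 1 = if w = 1 then -1 else 0 := by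
    have q := block_det_eq hP h0
    have q1 := q ![0, 1, 0, 0]
    have q2 := q ![0, 1, 1, 0]
    have q3 := q ![0, 1, 0, 1]
    simp only [sum_smul_four, Matrix.add_apply, Matrix.smul_apply, smul_eq_mul, h11, h12] at q1 q2 q3
    simp at q1 q2 q3
    intro w
    fin_cases w
    · simp [h0]
    · simp; linear_combination -q1
    · simp; linear_combination q1 - q2
    · simp; linear_combination q1 - q3
  -- the `y = 0` slice: `-(m₀₁ m₁₀ m₂₂)(0,0,z,t) = z³`
  have hzt : ∀ z t : K, (Z 2 0 1 * z + Z 3 0 1 * t) * (Z 2 1 0 * z + Z 3 1 0 * t) *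
      (Z 2 2 2 * z + Z 3 2 2 * t) = (-1) * z ^ 3 := by
    intro z t
    have h := hP ![0, 0, z, t]
    rw [sum_smul_four, eval_abvCubic, Matrix.det_fin_three] at h
    simp only [Matrix.add_apply, Matrix.smul_apply, smul_eq_mul, h11, h12, h21] at h
    simp at h
    linear_combination -h
  obtain ⟨h301, h310, h322⟩ := t_coeff_eq_zero_of_prod_eq _ _ _ _ _ _ (-1) (by norm_num) hzt
  -- evaluate at `(0, 1, 0, s)`
  have hs : ∀ s : K, (Z 1 + s • Z 3).det = s ^ 2 := by
    intro s
    have h := hP ![0, 1, 0, s]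
    rw [sum_smul_four, eval_abvCubic] at h
    simpa using h
  have e0 := hs 0
  have e1 := hs 1
  have e2 := hs 2
  rw [Matrix.det_fin_three] at e0 e1 e2
  simp only [Matrix.add_apply, Matrix.smul_apply, smul_eq_mul, h11, h12, h21, h301, h310, h322]
    at e0 e1 e2
  simp at e0 e1 e2
  have : (2 : K) = 0 := by linear_combination 2 * e1 - e0 - e2
  exact two_ne_zero this

omit [CharZero K] in
/-- Two-sided multiplication by constant matrices acts termwise on a linear pencil. [folklore] -/
private theorem mul_sum_smul_mul {n : Type*} [Fintype n] (G H : Matrix n n K) (Z : Fin 4 → Matrix n n K)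
    (v : Fin 4 → K) : G * (∑ w, v w • Z w) * H = ∑ w, v w • (G * Z w * H) := by
  rw [Finset.mul_sum, Finset.sum_mul]
  refine Finset.sum_congr rfl fun w _ => ?_
  rw [Matrix.mul_smul, Matrix.smul_mul]

/-- **Rank `1`, third normalisation**: if row `1` of the pencil is `(m₁₀, α y, β y)` then a unimodular
column operation on columns `1, 2` brings it to `(m₁₀, 0, y)`. [cite: AlperBogartVelasco2017, proof of Thm. 1.8] -/
theorem three_false_of_rank_one_c {Z : Fin 4 → Matrix (Fin 3) (Fin 3) K}
    (hP : ∀ v : Fin 4 → K, (∑ w, v w • Z w).det = 1 * MvPolynomial.eval v (abvCubic K))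
    (h0 : Z 0 = Matrix.diagonal ![(1 : K), 0, 0]) {α β : K}
    (h11 : ∀ w, Z w 1 1 = if w = 1 then α else 0) (h12 : ∀ w, Z w 1 2 = if w = 1 then β else 0) :
    False := by
  -- `(α, β) ≠ 0`: the block determinant at `e_y` is `1`
  have q1 := block_det_eq hP h0 ![0, 1, 0, 0]
  simp only [sum_smul_four, Matrix.add_apply, Matrix.smul_apply, smul_eq_mul, h11, h12] at q1
  simp at q1
  obtain ⟨α', β', hαβ⟩ : ∃ α' β' : K, α * α' + β * β' = 1 := by
    by_cases hβ : β = 0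
    · have hα : α ≠ 0 := by
        intro hα
        rw [hα, hβ] at q1
        simp at q1
      exact ⟨α⁻¹, 0, by simp [hα]⟩
    · exact ⟨0, β⁻¹, by simp [hβ]⟩
  let H : Matrix (Fin 3) (Fin 3) K := !![1, 0, 0; 0, β, α'; 0, -α, β']
  have hHdet : H.det = 1 := by
    simp [H, Matrix.det_fin_three]
    linear_combination hαβ
  refine three_false_of_rank_one_nf (Z := fun w => Z w * H) ?_ ?_ ?_ ?_
  · intro v
    have h : ∑ w, v w • (Z w * H) = (∑ w, v w • Z w) * H := by
      rw [Finset.sum_mul]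
      exact Finset.sum_congr rfl fun w _ => (Matrix.smul_mul _ _ _).symm
    rw [h, Matrix.det_mul, hHdet, mul_one, hP v]
  · show Z 0 * H = _
    rw [h0]
    ext i j
    fin_cases i <;> fin_cases j <;> simp [H, Matrix.mul_apply, Fin.sum_univ_three]
  · intro w
    show (Z w * H) 1 1 = 0
    simp [H, Matrix.mul_apply, Fin.sum_univ_three, h11 w, h12 w]
    split_ifs <;> ring
  · intro w
    show (Z w * H) 1 2 = _
    simp [H, Matrix.mul_apply, Fin.sum_univ_three, h11 w, h12 w]
    split_ifs
    · linear_combination hαβ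
    · ring

/-- **Rank `1`, second normalisation**: with the `y`-block equal to `1`, the `z`- and `t`-blocks
are traceless, singular and orthogonal (the block determinant is `y²`), hence have a common left
kernel vector `p`; the row operation with `p` makes row `1` of the `(1,2)`-block equal to
`(α y, β y)`. [cite: AlperBogartVelasco2017, proof of Thm. 1.8] -/
theorem three_false_of_rank_one_b {Z : Fin 4 → Matrix (Fin 3) (Fin 3) K}
    (hP : ∀ v : Fin 4 → K, (∑ w, v w • Z w).det = 1 * MvPolynomial.eval v (abvCubic K))
    (h0 : Z 0 = Matrix.diagonal ![(1 : K), 0, 0])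
    (hI : Z 1 1 1 = 1 ∧ Z 1 1 2 = 0 ∧ Z 1 2 1 = 0 ∧ Z 1 2 2 = 1) : False := by
  obtain ⟨hI11, hI12, hI21, hI22⟩ := hI
  have q := block_det_eq hP h0
  -- block determinant at `(0, 0, z, t)` and `(0, 1, z, t)`
  have hd : ∀ z t : K, (z * Z 2 1 1 + t * Z 3 1 1) * (z * Z 2 2 2 + t * Z 3 2 2) -
      (z * Z 2 1 2 + t * Z 3 1 2) * (z * Z 2 2 1 + t * Z 3 2 1) = 0 := by
    intro z t
    have h := q ![0, 0, z, t]
    simp only [sum_smul_four, Matrix.add_apply, Matrix.smul_apply, smul_eq_mul, h0] at h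
    simp at h
    linear_combination h
  have htr : ∀ z t : K, (z * Z 2 1 1 + t * Z 3 1 1) + (z * Z 2 2 2 + t * Z 3 2 2) = 0 := by
    intro z t
    have h := q ![0, 1, z, t]
    simp only [sum_smul_four, Matrix.add_apply, Matrix.smul_apply, smul_eq_mul, h0, hI11, hI12,
      hI21, hI22] at h
    simp at h
    linear_combination h - hd z t
  obtain ⟨p, hp, hpM, hpN⟩ := exists_common_vecMul_eq_zero
    !![Z 2 1 1, Z 2 1 2; Z 2 2 1, Z 2 2 2] !![Z 3 1 1, Z 3 1 2; Z 3 2 1, Z 3 2 2]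
    (by simpa using htr 1 0) (by simpa using hd 1 0) (by simpa using htr 0 1)
    (by simpa using hd 0 1)
    (by
      have h := hd 1 1
      have h1 := hd 1 0
      have h2 := hd 0 1
      simp at h h1 h2 ⊢
      linear_combination h - h1 - h2)
  have hpM0 : p 0 * Z 2 1 1 + p 1 * Z 2 2 1 = 0 := by
    have := congrFun hpM 0; simpa [Matrix.vecMul, dotProduct, Fin.sum_univ_two] using this
  have hpM1 : p 0 * Z 2 1 2 + p 1 * Z 2 2 2 = 0 := by
    have := congrFun hpM 1; simpa [Matrix.vecMul, dotProduct, Fin.sum_univ_two] using this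
  have hpN0 : p 0 * Z 3 1 1 + p 1 * Z 3 2 1 = 0 := by
    have := congrFun hpN 0; simpa [Matrix.vecMul, dotProduct, Fin.sum_univ_two] using this
  have hpN1 : p 0 * Z 3 1 2 + p 1 * Z 3 2 2 = 0 := by
    have := congrFun hpN 1; simpa [Matrix.vecMul, dotProduct, Fin.sum_univ_two] using this
  -- complete `p` to an invertible `2 × 2` matrix
  obtain ⟨g₀, g₁, hδ⟩ : ∃ g₀ g₁ : K, p 0 * g₁ - p 1 * g₀ ≠ 0 := by
    by_cases hp0 : p 0 = 0
    · have hp1 : p 1 ≠ 0 := fun h => hp (by ext i; fin_cases i <;> simp [hp0, h])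
      exact ⟨1, 0, by simp [hp0, hp1]⟩
    · exact ⟨0, 1, by simp [hp0]⟩
  set δ := p 0 * g₁ - p 1 * g₀ with hδdef
  let G : Matrix (Fin 3) (Fin 3) K := !![1, 0, 0; 0, p 0, p 1; 0, g₀, g₁]
  let H : Matrix (Fin 3) (Fin 3) K := !![1, 0, 0; 0, 1, 0; 0, 0, δ⁻¹]
  have hG : G.det = δ := by rw [hδdef]; simp [G, Matrix.det_fin_three]
  have hH : H.det = δ⁻¹ := by simp [H, Matrix.det_fin_three]
  have e11 : ∀ w, (G * Z w * H) 1 1 = p 0 * Z w 1 1 + p 1 * Z w 2 1 := by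
    intro w
    simp only [Matrix.mul_apply, Fin.sum_univ_three]
    simp [G, H]
  have e12 : ∀ w, (G * Z w * H) 1 2 = (p 0 * Z w 1 2 + p 1 * Z w 2 2) * δ⁻¹ := by
    intro w
    simp only [Matrix.mul_apply, Fin.sum_univ_three]
    simp [G, H]
  refine three_false_of_rank_one_c (Z := fun w => G * Z w * H) (α := p 0) (β := p 1 * δ⁻¹)
    ?_ ?_ ?_ ?_
  · intro v
    rw [← mul_sum_smul_mul, Matrix.det_mul, Matrix.det_mul, hG, hH, hP v]
    field_simp
  · show G * Z 0 * H = _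
    rw [h0]
    ext i j
    fin_cases i <;> fin_cases j <;>
      simp only [Matrix.mul_apply, Fin.sum_univ_three, Matrix.diagonal_apply] <;> simp [G, H]
  · intro w
    show (G * Z w * H) 1 1 = _
    rw [e11]
    fin_cases w
    · simp [h0]
    · simp [hI11, hI21]
    · simpa using hpM0
    · simpa using hpN0
  · intro w
    show (G * Z w * H) 1 2 = _
    rw [e12]
    fin_cases w
    · simp [h0]
    · simp [hI12, hI22]
    · simp [hpM1]
    · simp [hpN1]

/-- **Rank `1`, first normalisation**: with `Z_x = diag(1,0,0)` the `(1,2)`-block of `Z_y` has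
determinant `c ≠ 0`; multiplying rows `1, 2` by its inverse makes it the identity and the constant
`c` equal to `1`. [cite: AlperBogartVelasco2017, proof of Thm. 1.8] -/
theorem three_false_of_rank_one {Z : Fin 4 → Matrix (Fin 3) (Fin 3) K} {c : K} (hc : c ≠ 0)
    (hP : ∀ v : Fin 4 → K, (∑ w, v w • Z w).det = c * MvPolynomial.eval v (abvCubic K))
    (h0 : Z 0 = Matrix.diagonal ![(1 : K), 0, 0]) : False := by
  have q1 := block_det_eq hP h0 ![0, 1, 0, 0]
  simp [sum_smul_four] at q1
  let G : Matrix (Fin 3) (Fin 3) K :=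
    !![1, 0, 0; 0, c⁻¹ * Z 1 2 2, -(c⁻¹ * Z 1 1 2); 0, -(c⁻¹ * Z 1 2 1), c⁻¹ * Z 1 1 1]
  have hG : G.det = c⁻¹ := by
    simp [G, Matrix.det_fin_three]
    field_simp
    linear_combination q1
  refine three_false_of_rank_one_b (Z := fun w => G * Z w) ?_ ?_ ?_
  · intro v
    have h : ∑ w, v w • (G * Z w) = G * ∑ w, v w • Z w := by
      rw [Finset.mul_sum]
      exact Finset.sum_congr rfl fun w _ => (Matrix.mul_smul _ _ _).symm
    rw [h, Matrix.det_mul, hG, hP v]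
    field_simp
  · show G * Z 0 = _
    rw [h0]
    ext i j
    fin_cases i <;> fin_cases j <;> simp [G, Matrix.mul_apply, Fin.sum_univ_three]
  · refine ⟨?_, ?_, ?_, ?_⟩
    · show (G * Z 1) 1 1 = 1
      simp [G, Matrix.mul_apply, Fin.sum_univ_three]
      field_simp
      linear_combination q1
    · show (G * Z 1) 1 2 = 0
      simp [G, Matrix.mul_apply, Fin.sum_univ_three]
      ring
    · show (G * Z 1) 2 1 = 0
      simp [G, Matrix.mul_apply, Fin.sum_univ_three]
      ring
    · show (G * Z 1) 2 2 = 1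
      simp [G, Matrix.mul_apply, Fin.sum_univ_three]
      field_simp
      linear_combination q1

/-! #### Assembly of the `3 × 3` case -/

omit [CharZero K] in
/-- `fromBlocks 1 0 0 0` on `Fin 1 ⊕ Fin 2` is `diag(1,0,0)` reindexed. [folklore] -/
private theorem fromBlocks_one_two :
    (Matrix.fromBlocks 1 0 0 0 : Matrix (Fin 1 ⊕ Fin 2) (Fin 1 ⊕ Fin 2) K) =
      (Matrix.diagonal ![(1 : K), 0, 0]).submatrix finSumFinEquiv finSumFinEquiv := by
  ext (i | i) (j | j) <;> fin_cases i <;> fin_cases j <;>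
    simp [Matrix.fromBlocks, finSumFinEquiv, Fin.castAdd, Fin.natAdd]

omit [CharZero K] in
/-- `fromBlocks 1 0 0 0` on `Fin 2 ⊕ Fin 1` is `diag(1,1,0)` reindexed. [folklore] -/
private theorem fromBlocks_two_one :
    (Matrix.fromBlocks 1 0 0 0 : Matrix (Fin 2 ⊕ Fin 1) (Fin 2 ⊕ Fin 1) K) =
      (Matrix.diagonal ![(1 : K), 1, 0]).submatrix finSumFinEquiv finSumFinEquiv := by
  ext (i | i) (j | j) <;> fin_cases i <;> fin_cases j <;>
    simp [Matrix.fromBlocks, finSumFinEquiv, Fin.castAdd, Fin.natAdd]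

omit [CharZero K] in
/-- `fromBlocks 1 0 0 0` on `Fin 0 ⊕ Fin 3` is `0`. [folklore] -/
private theorem fromBlocks_zero_three :
    (Matrix.fromBlocks 1 0 0 0 : Matrix (Fin 0 ⊕ Fin 3) (Fin 0 ⊕ Fin 3) K) = 0 := by
  ext (i | i) (j | j)
  · exact i.elim0
  · exact i.elim0
  · exact j.elim0
  · simp

omit [CharZero K] in
/-- `fromBlocks 1 0 0 0` on `Fin 3 ⊕ Fin 0` is `1`. [folklore] -/
private theorem fromBlocks_three_zero :
    (Matrix.fromBlocks 1 0 0 0 : Matrix (Fin 3 ⊕ Fin 0) (Fin 3 ⊕ Fin 0) K) = 1 := by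
  ext (i | i) (j | j)
  · simp [Matrix.one_apply]
  · exact j.elim0
  · exact i.elim0
  · exact i.elim0

omit [CharZero K] in
/-- Transport of a linear pencil along `G · (−) · H` and a reindexing `σ`. [folklore] -/
private theorem det_sum_smul_conj {n : Type*} [Fintype n] [DecidableEq n] (G H : Matrix n n K)
    (σ : n ≃ n) (Z : Fin 4 → Matrix n n K) (v : Fin 4 → K) :
    (∑ w, v w • (G * Z w * H).submatrix σ σ).det = G.det * H.det * (∑ w, v w • Z w).det := by
  have h : ∑ w, v w • (G * Z w * H).submatrix σ σ = (G * (∑ w, v w • Z w) * H).submatrix σ σ := by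
    rw [mul_sum_smul_mul]
    ext i j
    simp [Matrix.sum_apply]
  rw [h, Matrix.det_submatrix_equiv_self, Matrix.det_mul, Matrix.det_mul]
  ring

/-- **No `3 × 3` matrix of linear forms has determinant `c · (x y² + y t² + z³)` with `c ≠ 0`**
(pencil form): Brundu–Logar's `dc(x y² + y t² + z³) > 3` as used by ABV (p0004.txt:L3, p0006.txt:L2),
proved here directly by the rank of the `x`-coefficient matrix (`Matrix.exists_rank_normal_form`)
and the four cases above. [cite: AlperBogartVelasco2017, Thm. 1.8 (dc > 3, after Brundu–Logar)] -/
theorem three_false {Z : Fin 4 → Matrix (Fin 3) (Fin 3) K} {c : K} (hc : c ≠ 0)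
    (hP : ∀ v : Fin 4 → K, (∑ w, v w • Z w).det = c * MvPolynomial.eval v (abvCubic K)) :
    False := by
  obtain ⟨G, H, e, hG, hH, hGH⟩ := exists_mul_mul_eq_fromBlocks (Z 0)
  have hr : (Z 0).rank ≤ 3 := by simpa using Matrix.rank_le_width (Z 0)
  have hc' : G.det * H.det * c ≠ 0 := mul_ne_zero (mul_ne_zero hG.ne_zero hH.ne_zero) hc
  -- the transported pencil, for any reindexing `σ`
  have hP' : ∀ σ : Fin 3 ≃ Fin 3, ∀ v : Fin 4 → K,
      (∑ w, v w • (G * Z w * H).submatrix σ σ).det =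
        (G.det * H.det * c) * MvPolynomial.eval v (abvCubic K) := by
    intro σ v
    rw [det_sum_smul_conj, hP v]
    ring
  revert e hr
  generalize (Z 0).rank = r
  intro e hGH hr
  interval_cases r
  · -- rank 0
    refine three_false_of_rank_zero hc' (hP' (Equiv.refl _)) ?_
    show (G * Z 0 * H).submatrix _ _ = 0
    rw [hGH, fromBlocks_zero_three]
    rfl
  · -- rank 1
    let σ : Fin 3 ≃ Fin 3 := (finSumFinEquiv (m := 1) (n := 2)).symm.trans e.symm
    refine three_false_of_rank_one hc' (hP' σ) ?_
    show (G * Z 0 * H).submatrix σ σ = _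
    rw [hGH, fromBlocks_one_two, Matrix.submatrix_submatrix, Matrix.submatrix_submatrix]
    have hcomp : ⇑finSumFinEquiv ∘ ⇑e ∘ ⇑σ = id := by
      funext i
      simp [σ]
    rw [hcomp, Matrix.submatrix_id_id]
  · -- rank 2
    let σ : Fin 3 ≃ Fin 3 := (finSumFinEquiv (m := 2) (n := 1)).symm.trans e.symm
    refine three_false_of_rank_two hc' (hP' σ) ?_
    show (G * Z 0 * H).submatrix σ σ = _
    rw [hGH, fromBlocks_two_one, Matrix.submatrix_submatrix, Matrix.submatrix_submatrix]
    have hcomp : ⇑finSumFinEquiv ∘ ⇑e ∘ ⇑σ = id := by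
      funext i
      simp [σ]
    rw [hcomp, Matrix.submatrix_id_id]
  · -- rank 3
    refine three_false_of_rank_three (hP' (Equiv.refl _)) ?_
    show (G * Z 0 * H).submatrix _ _ = 1
    rw [hGH, fromBlocks_three_zero, Matrix.submatrix_one_equiv]
    rfl

/-! #### From affine `3 × 3` matrices to linear pencils: `dc(f) > 3` -/

/-- **Leading coefficient of `s ↦ det (J + s N)`**: if `det (J + s N) = d s^m` for every scalar `s`
(`m` the size), then `det N = d` — via the polynomial `det (X N + J)` and its top coefficient
(`Polynomial.coeff_det_X_add_C_card`), over an infinite field. [folklore] -/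
private theorem det_eq_of_forall_det_add_smul {m : ℕ} (J N : Matrix (Fin m) (Fin m) K) (d : K)
    (h : ∀ s : K, (J + s • N).det = d * s ^ m) : N.det = d := by
  haveI : Infinite K := Infinite.of_injective (Nat.cast : ℕ → K) Nat.cast_injective
  let P : Polynomial K :=
    ((Polynomial.X : Polynomial K) • N.map Polynomial.C + J.map Polynomial.C).det
  have hev : ∀ s : K, P.eval s = (J + s • N).det := by
    intro s
    have h1 : P.eval s = ((Polynomial.evalRingHom s).mapMatrix
        ((Polynomial.X : Polynomial K) • N.map Polynomial.C + J.map Polynomial.C)).det := by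
      rw [← RingHom.map_det]
      rfl
    rw [h1]
    congr 1
    ext i j
    simp
    ring
  have hPQ : P = Polynomial.C d * Polynomial.X ^ m := by
    apply Polynomial.eq_of_infinite_eval_eq
    refine Set.infinite_univ.mono fun s _ => ?_
    simp only [Set.mem_setOf_eq]
    rw [hev, h s, Polynomial.eval_mul, Polynomial.eval_C, Polynomial.eval_pow, Polynomial.eval_X]
  have hc := Polynomial.coeff_det_X_add_C_card N J
  rw [Fintype.card_fin] at hc
  have : P.coeff m = d := by rw [hPQ, Polynomial.coeff_C_mul, Polynomial.coeff_X_pow_self, mul_one]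
  rw [← hc]
  exact this

/-- **No affine `3 × 3` determinantal expression of `c · (x y² + y t² + z³)`, `c ≠ 0`** — i.e.
`dc(x y² + y t² + z³) > 3` (ABV p0004.txt:L3 "moreover that `dc(f) > 3`", citing Brundu–Logar): the
cubic part of the determinant of an affine `3 × 3` matrix is the determinant of its linear part, to
which `three_false` applies. [cite: AlperBogartVelasco2017, Thm. 1.8 (dc > 3, after Brundu–Logar)] -/
theorem three_false_affine {B : Matrix (Fin 3) (Fin 3) (MvPolynomial (Fin 4) K)}
    (hB1 : ∀ i j, (B i j).totalDegree ≤ 1) {c : K} (hc : c ≠ 0)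
    (hdet : B.det = C c * abvCubic K) : False := by
  have hP := det_pencil_of_det_eq hB1 hdet
  refine three_false (Z := fun w => LRPencil.coeffMat B w) hc fun v => ?_
  refine det_eq_of_forall_det_add_smul (constPart B) _ _ fun s => ?_
  have h := hP (s • v)
  have hs : ∑ w, (s • v) w • LRPencil.coeffMat B w = s • ∑ w, v w • LRPencil.coeffMat B w := by
    rw [Finset.smul_sum]
    exact Finset.sum_congr rfl fun w _ => by rw [Pi.smul_apply, smul_eq_mul, mul_smul]
  rw [hs] at h
  rw [h, eval_abvCubic]
  simp only [Pi.smul_apply, smul_eq_mul]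
  ring

/-- **`dc(x y² + y t² + z³) > 3`** over a field of characteristic `0`: there is no affine
determinantal expression of size `3` (ABV p0004.txt:L3, after Brundu–Logar 1998; proved here
directly, see `three_false`). [cite: AlperBogartVelasco2017, Thm. 1.8 (dc > 3, after Brundu–Logar)] -/
theorem not_hasDetRepr_abvCubic_three : ¬ HasDetRepr (abvCubic K) 3 := by
  rintro ⟨B, hB1, hdet⟩
  exact three_false_affine hB1 one_ne_zero (by rw [hdet, map_one, one_mul])

end Three

/-! ### The `4 × 4` analysis (ABV p0006.txt:L1–L47): ranks `r = 0, 1, 4` and the expansions -/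

section Four

variable {K : Type*} [Field K]

/-- `det (diag(1,0,0,0) + s N) = s³ det N₍₁₂₃₎ + s⁴ det N`. [folklore] -/
private theorem det_diag_one_add_smul (N : Matrix (Fin 4) (Fin 4) K) (s : K) :
    (Matrix.diagonal ![(1 : K), 0, 0, 0] + s • N).det =
      s ^ 3 * (N.submatrix Fin.succ Fin.succ).det + s ^ 4 * N.det := by
  simp [Matrix.det_succ_row_zero, Fin.sum_univ_succ, Matrix.submatrix_apply, Fin.succAbove]
  ring

/-- `det (diag(1,1,0,0) + s N)` expanded in powers of `s`. [folklore] -/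
private theorem det_diag_one_one_add_smul (N : Matrix (Fin 4) (Fin 4) K) (s : K) :
    (Matrix.diagonal ![(1 : K), 1, 0, 0] + s • N).det =
      s ^ 2 * (N 2 2 * N 3 3 - N 2 3 * N 3 2) +
      s ^ 3 * ((N.submatrix ![0, 2, 3] ![0, 2, 3]).det + (N.submatrix ![1, 2, 3] ![1, 2, 3]).det) +
      s ^ 4 * N.det := by
  simp [Matrix.det_succ_row_zero, Fin.sum_univ_succ, Matrix.submatrix_apply, Fin.succAbove]
  ring

/-- `det (diag(1,1,1,0) + s N)` expanded in powers of `s`. [folklore] -/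
private theorem det_diag_one_one_one_add_smul (N : Matrix (Fin 4) (Fin 4) K) (s : K) :
    (Matrix.diagonal ![(1 : K), 1, 1, 0] + s • N).det =
      s * N 3 3 + s ^ 2 * (N 0 0 * N 3 3 - N 0 3 * N 3 0 + N 1 1 * N 3 3 - N 1 3 * N 3 1 +
        N 2 2 * N 3 3 - N 2 3 * N 3 2) +
      s ^ 3 * ((N.submatrix ![0, 1, 3] ![0, 1, 3]).det + (N.submatrix ![0, 2, 3] ![0, 2, 3]).det +
        (N.submatrix ![1, 2, 3] ![1, 2, 3]).det) + s ^ 4 * N.det := by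
  simp [Matrix.det_succ_row_zero, Fin.sum_univ_succ, Matrix.submatrix_apply, Fin.succAbove]
  ring

/-- Scaling the point scales a linear pencil. [folklore] -/
private theorem sum_smul_smul {n : Type*} (Z : Fin 4 → Matrix n n K) (v : Fin 4 → K) (s : K) :
    ∑ w, (s • v) w • Z w = s • ∑ w, v w • Z w := by
  rw [Finset.smul_sum]
  exact Finset.sum_congr rfl fun w _ => by rw [Pi.smul_apply, smul_eq_mul, mul_smul]

/-- Reindexing a linear pencil. [folklore] -/
private theorem submatrix_sum_smul {n l : Type*} (Z : Fin 4 → Matrix n n K) (v : Fin 4 → K)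
    (e f : l → n) : (∑ w, v w • Z w).submatrix e f = ∑ w, v w • (Z w).submatrix e f := by
  ext i j
  simp [Matrix.sum_apply]

variable [CharZero K]

/-- **Rank `0` of `L(0)` is impossible** (ABV p0006.txt:L2: "the rank `r` cannot be `0` … as `f`
is homogeneous of degree `3`"): `det` of a linear `4 × 4` pencil is homogeneous of degree `4`.
[cite: AlperBogartVelasco2017, proof of Thm. 1.8 (r = 0)] -/
theorem four_false_of_rank_zero {Z : Fin 4 → Matrix (Fin 4) (Fin 4) K} {c : K} (hc : c ≠ 0)
    (hP : ∀ v : Fin 4 → K, (∑ w, v w • Z w).det = c * MvPolynomial.eval v (abvCubic K)) :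
    False := by
  have h1 := hP ![0, 0, 1, 0]
  have h2 := hP ![0, 0, 2, 0]
  simp [sum_smul_four] at h1 h2
  rw [h1] at h2
  have : (8 : K) * c = 0 := by linear_combination h2
  rcases mul_eq_zero.1 this with h | h
  · norm_num at h
  · exact hc h

/-- **Rank `4` of `L(0)` is impossible** (ABV p0006.txt:L2: "… or `4` as `f` is homogeneous"):
`det L(0) = f(0) = 0`. [cite: AlperBogartVelasco2017, proof of Thm. 1.8 (r = 4)] -/
theorem four_false_of_rank_four {Z : Fin 4 → Matrix (Fin 4) (Fin 4) K} {c : K}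
    (hP : ∀ v : Fin 4 → K, (1 + ∑ w, v w • Z w).det = c * MvPolynomial.eval v (abvCubic K)) :
    False := by
  have h := hP 0
  simp [abvCubic] at h

/-- **Rank `1` of `L(0)` is impossible** (ABV p0006.txt:L2: "If `r = 1`, the degree `3` component
of `det(L)` … gives a determinantal expression of `f` of size `3`, contradicting the fact that
`dc(f) > 3`"): with `L(0) = diag(1,0,0,0)` the coefficient of `s³` in `det L(s v)` is the
determinant of the complementary `3 × 3` linear pencil, to which `three_false` applies.
[cite: AlperBogartVelasco2017, proof of Thm. 1.8 (r = 1)] -/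
theorem four_false_of_rank_one {Z : Fin 4 → Matrix (Fin 4) (Fin 4) K} {c : K} (hc : c ≠ 0)
    (hP : ∀ v : Fin 4 → K, (Matrix.diagonal ![(1 : K), 0, 0, 0] + ∑ w, v w • Z w).det =
      c * MvPolynomial.eval v (abvCubic K)) : False := by
  refine three_false (Z := fun w => (Z w).submatrix Fin.succ Fin.succ) hc fun v => ?_
  rw [← submatrix_sum_smul]
  have key := coeff_eq_zero_of_forall 0 0 0
    (((∑ w, v w • Z w).submatrix Fin.succ Fin.succ).det -
      c * (v 0 * v 1 ^ 2 + v 1 * v 3 ^ 2 + v 2 ^ 3))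
    (∑ w, v w • Z w).det (fun s => by
      have h := hP (s • v)
      rw [sum_smul_smul, det_diag_one_add_smul, eval_abvCubic] at h
      simp only [Pi.smul_apply, smul_eq_mul] at h
      linear_combination h)
  rw [eval_abvCubic]
  linear_combination key.2.2.2.1

end Four

/-! ### The `4 × 4` analysis, rank `r = 2` (ABV p0006.txt:L4–L17) -/

section FourTwo

variable {K : Type*} [Field K]

/-- Entries of a pencil as dot products of the point with the coefficient vectors. [folklore] -/
private theorem pencil_apply_dot {n : Type*} (J : Matrix n n K) (Z : Fin 4 → Matrix n n K)
    (v : Fin 4 → K) (i j : n) : (J + ∑ w, v w • Z w) i j = J i j + (fun w => Z w i j) ⬝ᵥ v := by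
  simp [dotProduct, Fin.sum_univ_four, mul_comm]

/-- **A product of two linear forms vanishing identically has a zero factor.** [folklore] -/
private theorem eq_zero_or_eq_zero_of_dotProduct_mul (a b : Fin 4 → K)
    (h : ∀ v : Fin 4 → K, (a ⬝ᵥ v) * (b ⬝ᵥ v) = 0) : a = 0 ∨ b = 0 := by
  by_contra hab
  push Not at hab
  obtain ⟨ha, hb⟩ := hab
  obtain ⟨i, hi⟩ := Function.ne_iff.1 ha
  obtain ⟨j, hj⟩ := Function.ne_iff.1 hb
  have h1 := h (Pi.single i 1)
  have h2 := h (Pi.single j 1)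
  have h3 := h (Pi.single i 1 + Pi.single j 1)
  simp only [dotProduct_add, dotProduct_single, mul_one] at h1 h2 h3
  have hbi : b i = 0 := (mul_eq_zero.1 h1).resolve_left hi
  have haj : a j = 0 := (mul_eq_zero.1 h2).resolve_right hj
  rw [hbi, haj, zero_add, add_zero] at h3
  rcases mul_eq_zero.1 h3 with h | h
  · exact hi h
  · exact hj h

/-- **A linear form vanishing on the kernel of a nonzero linear form is a multiple of it.** [folklore] -/
private theorem exists_eq_smul_of_dotProduct (a c : Fin 4 → K) (hc : c ≠ 0)
    (h : ∀ v : Fin 4 → K, c ⬝ᵥ v = 0 → a ⬝ᵥ v = 0) : ∃ μ : K, a = μ • c := by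
  obtain ⟨i, hi⟩ := Function.ne_iff.1 hc
  have hi' : c i ≠ 0 := by simpa using hi
  refine ⟨a i / c i, ?_⟩
  funext j
  have key := h (Pi.single j 1 - (c j / c i) • Pi.single i 1) (by
    simp only [dotProduct_sub, dotProduct_smul, dotProduct_single, mul_one, smul_eq_mul]
    rw [div_mul_cancel₀ _ hi', sub_self])
  simp only [dotProduct_sub, dotProduct_smul, dotProduct_single, mul_one, smul_eq_mul] at key
  simp only [Pi.smul_apply, smul_eq_mul]
  field_simp at key
  field_simp
  linear_combination key

/-- **A product of two linear forms vanishing on a hyperplane**: one factor is a multiple of the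
hyperplane's equation (ABV p0006.txt:L5: "either `Z₁₂` or `Z₂₁` is a multiple of `Z₁₁`").
[cite: AlperBogartVelasco2017, proof of Thm. 1.8 (r = 2)] -/
theorem exists_eq_smul_or_of_dotProduct_mul (a b c : Fin 4 → K) (hc : c ≠ 0)
    (h : ∀ v : Fin 4 → K, c ⬝ᵥ v = 0 → (a ⬝ᵥ v) * (b ⬝ᵥ v) = 0) :
    (∃ μ : K, a = μ • c) ∨ (∃ μ : K, b = μ • c) := by
  by_cases ha : ∀ v : Fin 4 → K, c ⬝ᵥ v = 0 → a ⬝ᵥ v = 0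
  · exact Or.inl (exists_eq_smul_of_dotProduct a c hc ha)
  · right
    refine exists_eq_smul_of_dotProduct b c hc fun v hv => ?_
    push Not at ha
    obtain ⟨u, hu, hau⟩ := ha
    by_contra hbv
    have hbu : b ⬝ᵥ u = 0 := by
      have := h u hu
      rcases mul_eq_zero.1 this with h' | h'
      · exact absurd h' hau
      · exact h'
    have hav : a ⬝ᵥ v = 0 := by
      have := h v hv
      rcases mul_eq_zero.1 this with h' | h'
      · exact h'
      · exact absurd h' hbv
    have h3 := h (u + v) (by rw [dotProduct_add, hu, hv, add_zero])
    rw [dotProduct_add, dotProduct_add, hbu, hav, zero_add, add_zero] at h3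
    rcases mul_eq_zero.1 h3 with h' | h'
    · exact hau h'
    · exact hbv h'

variable [CharZero K]

/-- With `L(0) = diag(1,1,0,0)`: the quadratic part `Z₂₂ Z₃₃ - Z₂₃ Z₃₂` of `det L` vanishes and
the cubic part `det Z₍₀₂₃₎ + det Z₍₁₂₃₎` is `c·f` (ABV p0006.txt:L4: "If `r = 2`, then
`Z₁₁Z₂₂ - Z₁₂Z₂₁ = 0`"), pointwise. [cite: AlperBogartVelasco2017, proof of Thm. 1.8 (r = 2)] -/
theorem four_two_coeffs {Z : Fin 4 → Matrix (Fin 4) (Fin 4) K} {c : K}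
    (hP : ∀ v : Fin 4 → K, (Matrix.diagonal ![(1 : K), 1, 0, 0] + ∑ w, v w • Z w).det =
      c * MvPolynomial.eval v (abvCubic K)) (v : Fin 4 → K) :
    (∑ w, v w • Z w) 2 2 * (∑ w, v w • Z w) 3 3 - (∑ w, v w • Z w) 2 3 * (∑ w, v w • Z w) 3 2 = 0 ∧
    ((∑ w, v w • Z w).submatrix ![0, 2, 3] ![0, 2, 3]).det +
      ((∑ w, v w • Z w).submatrix ![1, 2, 3] ![1, 2, 3]).det =
        c * (v 0 * v 1 ^ 2 + v 1 * v 3 ^ 2 + v 2 ^ 3) := by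
  have key := coeff_eq_zero_of_forall 0 0
    ((∑ w, v w • Z w) 2 2 * (∑ w, v w • Z w) 3 3 - (∑ w, v w • Z w) 2 3 * (∑ w, v w • Z w) 3 2)
    (((∑ w, v w • Z w).submatrix ![0, 2, 3] ![0, 2, 3]).det +
      ((∑ w, v w • Z w).submatrix ![1, 2, 3] ![1, 2, 3]).det -
        c * (v 0 * v 1 ^ 2 + v 1 * v 3 ^ 2 + v 2 ^ 3))
    (∑ w, v w • Z w).det (fun s => by
      have h := hP (s • v)
      rw [sum_smul_smul, det_diag_one_one_add_smul, eval_abvCubic] at h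
      simp only [Pi.smul_apply, smul_eq_mul] at h
      linear_combination h)
  exact ⟨key.2.2.1, by linear_combination key.2.2.2.1⟩

/-- **Rank `2`, final form** — column `3` of `Z` equal to `(y, z, 0, 0)`: the cubic part of
`det L` is `y (Z₂₀Z₃₂ - Z₂₂Z₃₀) + z (Z₂₁Z₃₂ - Z₂₂Z₃₁)` (ABV's display p0006.txt:L6–L13, up to
relabelling), so `f` vanishes wherever `Z₃₂ = Z₂₂ = 0`, whence `Z₃₂, Z₂₂ ∈ ⟨y, z⟩` by the unique
line (p0006.txt:L17) and "`f ∈ (y,z)²`, a contradiction": at `(0,1,0,s)` the cubic part is affine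
in `s` while `f = s²`. [cite: AlperBogartVelasco2017, proof of Thm. 1.8 (r = 2)] -/
theorem four_false_of_rank_two_nf {Z : Fin 4 → Matrix (Fin 4) (Fin 4) K} {c : K} (hc : c ≠ 0)
    (hP : ∀ v : Fin 4 → K, (Matrix.diagonal ![(1 : K), 1, 0, 0] + ∑ w, v w • Z w).det =
      c * MvPolynomial.eval v (abvCubic K))
    (h03 : ∀ w, Z w 0 3 = if w = 1 then 1 else 0) (h13 : ∀ w, Z w 1 3 = if w = 2 then 1 else 0)
    (h23 : ∀ w, Z w 2 3 = 0) (h33 : ∀ w, Z w 3 3 = 0) : False := by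
  -- the cubic part, written out
  have hcubic : ∀ v : Fin 4 → K, c * (v 0 * v 1 ^ 2 + v 1 * v 3 ^ 2 + v 2 ^ 3) =
      v 1 * ((∑ w, v w • Z w) 2 0 * (∑ w, v w • Z w) 3 2 - (∑ w, v w • Z w) 2 2 * (∑ w, v w • Z w) 3 0)
      + v 2 * ((∑ w, v w • Z w) 2 1 * (∑ w, v w • Z w) 3 2 -
          (∑ w, v w • Z w) 2 2 * (∑ w, v w • Z w) 3 1) := by
    intro v
    have h := (four_two_coeffs hP v).2
    have e03 : (∑ w, v w • Z w) 0 3 = v 1 := by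
      rw [Matrix.sum_apply]; simp [h03]
    have e13 : (∑ w, v w • Z w) 1 3 = v 2 := by
      rw [Matrix.sum_apply]; simp [h13]
    have e23 : (∑ w, v w • Z w) 2 3 = 0 := by
      rw [Matrix.sum_apply]; simp [h23]
    have e33 : (∑ w, v w • Z w) 3 3 = 0 := by
      rw [Matrix.sum_apply]; simp [h33]
    rw [Matrix.det_fin_three, Matrix.det_fin_three] at h
    simp only [Matrix.submatrix_apply, Matrix.cons_val_zero, Matrix.cons_val_one,
      Matrix.cons_val_two, Matrix.head_cons, Matrix.tail_cons, e03, e13, e23, e33] at h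
    linear_combination -h
  -- `f` vanishes where `Z₃₂ = Z₂₂ = 0`
  have hvan := coeff_zero_of_vanish_two (fun w => Z w 3 2) (fun w => Z w 2 2) fun v h32 h22 => by
    have e32 : (∑ w, v w • Z w) 3 2 = 0 := by
      have := pencil_apply_dot 0 Z v 3 2
      rw [zero_add] at this
      rw [this, Matrix.zero_apply, zero_add, h32]
    have e22 : (∑ w, v w • Z w) 2 2 = 0 := by
      have := pencil_apply_dot 0 Z v 2 2
      rw [zero_add] at this
      rw [this, Matrix.zero_apply, zero_add, h22]
    have h := hcubic v
    rw [e32, e22] at h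
    have : c * (v 0 * v 1 ^ 2 + v 1 * v 3 ^ 2 + v 2 ^ 3) = 0 := by linear_combination h
    rcases mul_eq_zero.1 this with h' | h'
    · exact absurd h' hc
    · exact h'
  obtain ⟨⟨-, h332⟩, ⟨-, h322⟩, -⟩ := hvan
  -- evaluate at `(0, 1, 0, s)`
  have e0 := hcubic ![0, 1, 0, 0]
  have e1 := hcubic ![0, 1, 0, 1]
  have e2 := hcubic ![0, 1, 0, 2]
  simp only [sum_smul_four, Matrix.add_apply, Matrix.smul_apply, smul_eq_mul] at e0 e1 e2
  simp [h332, h322] at e0 e1 e2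
  have : (2 : K) * c = 0 := by linear_combination e0 - 2 * e1 + e2
  rcases mul_eq_zero.1 this with h | h
  · exact two_ne_zero h
  · exact hc h

/-! #### Transport of the pencil identity along the symmetries of `det` -/

omit [CharZero K] in
/-- Transposition. [folklore] -/
private theorem pencil_det_transpose {n : Type*} [Fintype n] [DecidableEq n] {J : Matrix n n K}
    (hJ : Jᵀ = J) {Z : Fin 4 → Matrix n n K} {c : K}
    (hP : ∀ v : Fin 4 → K, (J + ∑ w, v w • Z w).det = c * MvPolynomial.eval v (abvCubic K)) :
    ∀ v : Fin 4 → K, (J + ∑ w, v w • (Z w)ᵀ).det = c * MvPolynomial.eval v (abvCubic K) := by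
  intro v
  have h : J + ∑ w, v w • (Z w)ᵀ = (J + ∑ w, v w • Z w)ᵀ := by rw [transpose_pencil, hJ]
  rw [h, Matrix.det_transpose, hP v]

omit [CharZero K] in
/-- Simultaneous reindexing of rows and columns. [folklore] -/
private theorem pencil_det_submatrix {n : Type*} [Fintype n] [DecidableEq n] {J : Matrix n n K}
    (σ : n ≃ n) (hJ : J.submatrix σ σ = J) {Z : Fin 4 → Matrix n n K} {c : K}
    (hP : ∀ v : Fin 4 → K, (J + ∑ w, v w • Z w).det = c * MvPolynomial.eval v (abvCubic K)) :
    ∀ v : Fin 4 → K, (J + ∑ w, v w • (Z w).submatrix σ σ).det =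
      c * MvPolynomial.eval v (abvCubic K) := by
  intro v
  have h : J + ∑ w, v w • (Z w).submatrix σ σ = (J + ∑ w, v w • Z w).submatrix σ σ := by
    rw [submatrix_pencil, hJ]
  rw [h, Matrix.det_submatrix_equiv_self, hP v]

omit [CharZero K] in
/-- Conjugation by `P` with inverse `Q` fixing `J`. [folklore] -/
private theorem pencil_det_conj {n : Type*} [Fintype n] [DecidableEq n] {J : Matrix n n K}
    (P Q : Matrix n n K) (hPQ : P * Q = 1) (hJ : P * J * Q = J) {Z : Fin 4 → Matrix n n K}
    {c : K} (hP : ∀ v : Fin 4 → K, (J + ∑ w, v w • Z w).det = c * MvPolynomial.eval v (abvCubic K)) :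
    ∀ v : Fin 4 → K, (J + ∑ w, v w • (P * Z w * Q)).det = c * MvPolynomial.eval v (abvCubic K) := by
  intro v
  have h : J + ∑ w, v w • (P * Z w * Q) = P * (J + ∑ w, v w • Z w) * Q := by
    rw [mul_pencil_mul, hJ]
  rw [h, Matrix.det_mul, Matrix.det_mul, ← hP v]
  have hd : P.det * Q.det = 1 := by rw [← Matrix.det_mul, hPQ, Matrix.det_one]
  linear_combination (J + ∑ w, v w • Z w).det * hd

/-- **Rank `2`, cleared column** — if `Z₂₃ = Z₃₃ = 0` (ABV: "we can reduce to the case that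
`Z₁₁ = Z₂₁ = 0`", p0006.txt:L4, up to relabelling), then column `3` of `L` consists of two linear
forms cutting out a plane of the surface, hence spanning `⟨y, z⟩` (unique line); conjugating by the
corresponding `GL₂` on the first two indices ("replace `L` with `P L P⁻¹` so that `Z₃₁ = y` and
`Z₄₁ = z`", p0006.txt:L4–L5) brings column `3` to `(y, z, 0, 0)`. [cite: AlperBogartVelasco2017, proof of Thm. 1.8 (r = 2)] -/
theorem four_false_of_rank_two_col {Z : Fin 4 → Matrix (Fin 4) (Fin 4) K} {c : K} (hc : c ≠ 0)
    (hP : ∀ v : Fin 4 → K, (Matrix.diagonal ![(1 : K), 1, 0, 0] + ∑ w, v w • Z w).det =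
      c * MvPolynomial.eval v (abvCubic K))
    (h23 : ∀ w, Z w 2 3 = 0) (h33 : ∀ w, Z w 3 3 = 0) : False := by
  -- the two forms of column `3`
  have hvan := coeff_zero_of_vanish_two (fun w => Z w 0 3) (fun w => Z w 1 3) fun v h0 h1 => by
    have hdet : (Matrix.diagonal ![(1 : K), 1, 0, 0] + ∑ w, v w • Z w).det = 0 := by
      refine Matrix.det_eq_zero_of_column_eq_zero 3 fun i => ?_
      rw [pencil_apply_dot]
      fin_cases i
      · simpa using h0
      · simpa using h1
      · simp [dotProduct, h23]
      · simp [dotProduct, h33]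
    have h := hP v
    rw [hdet, eval_abvCubic] at h
    rcases mul_eq_zero.1 h.symm with h' | h'
    · exact absurd h' hc
    · exact h'
  obtain ⟨⟨ha0, ha3⟩, ⟨hb0, hb3⟩, hδ⟩ := hvan
  set a1 := Z 1 0 3
  set a2 := Z 2 0 3
  set b1 := Z 1 1 3
  set b2 := Z 2 1 3
  set δ := a1 * b2 - a2 * b1 with hδdef
  let P : Matrix (Fin 4) (Fin 4) K :=
    !![b2 / δ, -a2 / δ, 0, 0; -b1 / δ, a1 / δ, 0, 0; 0, 0, 1, 0; 0, 0, 0, 1]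
  let Q : Matrix (Fin 4) (Fin 4) K := !![a1, a2, 0, 0; b1, b2, 0, 0; 0, 0, 1, 0; 0, 0, 0, 1]
  have hPQ : P * Q = 1 := by
    ext i j
    fin_cases i <;> fin_cases j <;>
      simp only [Matrix.mul_apply, Fin.sum_univ_four, Matrix.one_apply] <;> simp [P, Q] <;>
      field_simp <;> ring
  have hJ : P * Matrix.diagonal ![(1 : K), 1, 0, 0] * Q = Matrix.diagonal ![(1 : K), 1, 0, 0] := by
    ext i j
    fin_cases i <;> fin_cases j <;>
      simp only [Matrix.mul_apply, Fin.sum_univ_four, Matrix.diagonal_apply] <;> simp [P, Q] <;>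
      field_simp <;> ring
  have hP' := pencil_det_conj P Q hPQ hJ hP
  have ecol : ∀ w (i : Fin 4), (P * Z w * Q) i 3 =
      P i 0 * Z w 0 3 + P i 1 * Z w 1 3 + P i 2 * Z w 2 3 + P i 3 * Z w 3 3 := by
    intro w i
    simp only [Matrix.mul_apply, Fin.sum_univ_four]
    simp [Q]
  have hw : ∀ w : Fin 4, Z w 0 3 = (if w = 1 then a1 else 0) + (if w = 2 then a2 else 0) ∧
      Z w 1 3 = (if w = 1 then b1 else 0) + (if w = 2 then b2 else 0) := by
    intro w
    fin_cases w
    · exact ⟨by simpa using ha0, by simpa using hb0⟩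
    · simp [a1, b1]
    · simp [a2, b2]
    · exact ⟨by simpa using ha3, by simpa using hb3⟩
  refine four_false_of_rank_two_nf (Z := fun w => P * Z w * Q) hc hP' ?_ ?_ ?_ ?_
  · intro w
    show (P * Z w * Q) 0 3 = _
    rw [ecol, (hw w).1, (hw w).2, h23, h33]
    fin_cases w <;> simp [P] <;> field_simp <;> ring
  · intro w
    show (P * Z w * Q) 1 3 = _
    rw [ecol, (hw w).1, (hw w).2, h23, h33]
    fin_cases w <;> simp [P] <;> field_simp <;> ring
  · intro w
    show (P * Z w * Q) 2 3 = 0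
    rw [ecol, h23, h33]
    simp [P]
  · intro w
    show (P * Z w * Q) 3 3 = 0
    rw [ecol, h23, h33]
    simp [P]

/-- **Rank `2`, proportional entries** — if `Z₂₃ = μ Z₂₂` and `Z₃₃ = μ Z₃₂` then conjugating by
the elementary matrix `1 + μ E₂₃` clears `Z₂₃` and `Z₃₃` (ABV p0006.txt:L5: "we may replace `L`
by `P⁻¹ L P` … so that `Z₁₂ = 0`. But then `Z₂₂ = 0`"). [cite: AlperBogartVelasco2017, proof of Thm. 1.8 (r = 2)] -/
theorem four_false_of_rank_two_rel {Z : Fin 4 → Matrix (Fin 4) (Fin 4) K} {c : K} (hc : c ≠ 0)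
    (hP : ∀ v : Fin 4 → K, (Matrix.diagonal ![(1 : K), 1, 0, 0] + ∑ w, v w • Z w).det =
      c * MvPolynomial.eval v (abvCubic K))
    (μ : K) (h23 : ∀ w, Z w 2 3 = μ * Z w 2 2) (h33 : ∀ w, Z w 3 3 = μ * Z w 3 2) : False := by
  let P : Matrix (Fin 4) (Fin 4) K := !![1, 0, 0, 0; 0, 1, 0, 0; 0, 0, 1, μ; 0, 0, 0, 1]
  let Q : Matrix (Fin 4) (Fin 4) K := !![1, 0, 0, 0; 0, 1, 0, 0; 0, 0, 1, -μ; 0, 0, 0, 1]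
  have hPQ : P * Q = 1 := by
    ext i j
    fin_cases i <;> fin_cases j <;>
      simp only [Matrix.mul_apply, Fin.sum_univ_four, Matrix.one_apply] <;> simp [P, Q]
  have hJ : P * Matrix.diagonal ![(1 : K), 1, 0, 0] * Q = Matrix.diagonal ![(1 : K), 1, 0, 0] := by
    ext i j
    fin_cases i <;> fin_cases j <;>
      simp only [Matrix.mul_apply, Fin.sum_univ_four, Matrix.diagonal_apply] <;> simp [P, Q]
  have hP' := pencil_det_conj P Q hPQ hJ hP
  refine four_false_of_rank_two_col (Z := fun w => P * Z w * Q) hc hP' ?_ ?_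
  · intro w
    show (P * Z w * Q) 2 3 = 0
    simp only [Matrix.mul_apply, Fin.sum_univ_four]
    simp [P, Q, h23 w, h33 w]
    ring
  · intro w
    show (P * Z w * Q) 3 3 = 0
    simp only [Matrix.mul_apply, Fin.sum_univ_four]
    simp [P, Q, h33 w]
    ring

/-- **Rank `2` of `L(0)` is impossible** (ABV p0006.txt:L4–L17). With `L(0) = diag(1,1,0,0)`
the quadratic part of `det L` is `Z₂₂Z₃₃ - Z₂₃Z₃₂ = 0` (products of linear forms), so — after a
transposition and/or the swap of the indices `2, 3` — either a column of the zero block vanishes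
(`four_false_of_rank_two_col`) or `Z₂₃, Z₃₃` are the `μ`-multiples of `Z₂₂, Z₃₂`
(`four_false_of_rank_two_rel`). [cite: AlperBogartVelasco2017, proof of Thm. 1.8 (r = 2)] -/
theorem four_false_of_rank_two {Z : Fin 4 → Matrix (Fin 4) (Fin 4) K} {c : K} (hc : c ≠ 0)
    (hP : ∀ v : Fin 4 → K, (Matrix.diagonal ![(1 : K), 1, 0, 0] + ∑ w, v w • Z w).det =
      c * MvPolynomial.eval v (abvCubic K)) : False := by
  -- symmetries of `J = diag(1,1,0,0)`
  have hJt : (Matrix.diagonal ![(1 : K), 1, 0, 0])ᵀ = Matrix.diagonal ![(1 : K), 1, 0, 0] :=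
    Matrix.diagonal_transpose _
  let σ : Fin 4 ≃ Fin 4 := Equiv.swap 2 3
  have hJσ : (Matrix.diagonal ![(1 : K), 1, 0, 0]).submatrix σ σ =
      Matrix.diagonal ![(1 : K), 1, 0, 0] := by
    ext i j
    fin_cases i <;> fin_cases j <;> simp [σ, Equiv.swap_apply_def]
  -- the quadratic relation, as products of linear forms
  have hA : ∀ v : Fin 4 → K, ((fun w => Z w 2 2) ⬝ᵥ v) * ((fun w => Z w 3 3) ⬝ᵥ v) -
      ((fun w => Z w 2 3) ⬝ᵥ v) * ((fun w => Z w 3 2) ⬝ᵥ v) = 0 := by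
    intro v
    have h := (four_two_coeffs hP v).1
    have e := fun i j => pencil_apply_dot (0 : Matrix (Fin 4) (Fin 4) K) Z v i j
    simp only [zero_add, Matrix.zero_apply] at e
    rw [e, e, e, e] at h
    exact h
  by_cases h22 : (fun w => Z w 2 2) = 0
  · have h22' : ∀ w, Z w 2 2 = 0 := fun w => congrFun h22 w
    have hprod : ∀ v : Fin 4 → K, ((fun w => Z w 2 3) ⬝ᵥ v) * ((fun w => Z w 3 2) ⬝ᵥ v) = 0 := by
      intro v
      have h := hA v
      rw [h22, zero_dotProduct, zero_mul, zero_sub, neg_eq_zero] at h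
      exact h
    rcases eq_zero_or_eq_zero_of_dotProduct_mul _ _ hprod with h23 | h32
    · -- row `2` of the zero block vanishes: transpose, then swap `2 ↔ 3`
      have h23' : ∀ w, Z w 2 3 = 0 := fun w => congrFun h23 w
      refine four_false_of_rank_two_col (Z := fun w => ((Z w)ᵀ).submatrix σ σ) hc
        (pencil_det_submatrix σ hJσ (pencil_det_transpose hJt hP)) ?_ ?_
      · intro w
        show (Z w)ᵀ (σ 2) (σ 3) = 0
        simp [σ, h23']
      · intro w
        show (Z w)ᵀ (σ 3) (σ 3) = 0
        simp [σ, h22']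
    · -- column `2` of the zero block vanishes: swap `2 ↔ 3`
      have h32' : ∀ w, Z w 3 2 = 0 := fun w => congrFun h32 w
      refine four_false_of_rank_two_col (Z := fun w => (Z w).submatrix σ σ) hc
        (pencil_det_submatrix σ hJσ hP) ?_ ?_
      · intro w
        show Z w (σ 2) (σ 3) = 0
        simp [σ, h32']
      · intro w
        show Z w (σ 3) (σ 3) = 0
        simp [σ, h22']
  · rcases exists_eq_smul_or_of_dotProduct_mul (fun w => Z w 2 3) (fun w => Z w 3 2)
        (fun w => Z w 2 2) h22 (fun v hv => by
          have h := hA v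
          rw [hv, zero_mul, zero_sub, neg_eq_zero] at h
          exact h) with ⟨μ, hμ⟩ | ⟨μ, hμ⟩
    · -- `Z₂₃ = μ Z₂₂`, hence `Z₃₃ = μ Z₃₂`
      have h33 : (fun w => Z w 3 3) - μ • (fun w => Z w 3 2) = 0 := by
        rcases eq_zero_or_eq_zero_of_dotProduct_mul (fun w => Z w 2 2)
            ((fun w => Z w 3 3) - μ • (fun w => Z w 3 2)) (fun v => by
              have h := hA v
              rw [hμ, smul_dotProduct, smul_eq_mul] at h
              rw [sub_dotProduct, smul_dotProduct, smul_eq_mul]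
              linear_combination h) with h | h
        · exact absurd h h22
        · exact h
      refine four_false_of_rank_two_rel hc hP μ (fun w => ?_) (fun w => ?_)
      · have := congrFun hμ w; simpa using this
      · have := congrFun h33 w
        simp only [Pi.sub_apply, Pi.smul_apply, smul_eq_mul, Pi.zero_apply] at this
        linear_combination this
    · -- `Z₃₂ = μ Z₂₂`: transpose first
      have h33 : (fun w => Z w 3 3) - μ • (fun w => Z w 2 3) = 0 := by
        rcases eq_zero_or_eq_zero_of_dotProduct_mul (fun w => Z w 2 2)
            ((fun w => Z w 3 3) - μ • (fun w => Z w 2 3)) (fun v => by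
              have h := hA v
              rw [hμ, smul_dotProduct, smul_eq_mul] at h
              rw [sub_dotProduct, smul_dotProduct, smul_eq_mul]
              linear_combination h) with h | h
        · exact absurd h h22
        · exact h
      refine four_false_of_rank_two_rel (Z := fun w => (Z w)ᵀ) hc (pencil_det_transpose hJt hP) μ
        (fun w => ?_) (fun w => ?_)
      · show Z w 3 2 = μ * Z w 2 2
        have := congrFun hμ w; simpa using this
      · show Z w 3 3 = μ * Z w 2 3
        have := congrFun h33 w
        simp only [Pi.sub_apply, Pi.smul_apply, smul_eq_mul, Pi.zero_apply] at this
        linear_combination this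

end FourTwo

/-! ### The `4 × 4` analysis, rank `r = 3` (ABV p0006.txt:L19–L47) — the endgame -/

section FourThree

variable {K : Type*} [Field K] [CharZero K]

/-- With `L(0) = diag(1,1,1,0)`: pointwise, `Z₃₃ = 0`, the quadratic part
`Σ_{j<3} (Z_jj Z₃₃ - Z_j3 Z_3j)` vanishes, the cubic part (the three principal `3 × 3` minors through
the index `3`) is `c·f`, and `det Z = 0` (ABV p0006.txt:L19: "we know that `Z₁₁ = 0` and
`Z₁₂Z₂₁ + Z₁₃Z₃₁ + Z₁₄Z₄₁ = 0`"). [cite: AlperBogartVelasco2017, proof of Thm. 1.8 (r = 3)] -/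
theorem four_three_coeffs {Z : Fin 4 → Matrix (Fin 4) (Fin 4) K} {c : K}
    (hP : ∀ v : Fin 4 → K, (Matrix.diagonal ![(1 : K), 1, 1, 0] + ∑ w, v w • Z w).det =
      c * MvPolynomial.eval v (abvCubic K)) (v : Fin 4 → K) :
    (∑ w, v w • Z w) 3 3 = 0 ∧
    ((∑ w, v w • Z w) 0 0 * (∑ w, v w • Z w) 3 3 - (∑ w, v w • Z w) 0 3 * (∑ w, v w • Z w) 3 0 +
      (∑ w, v w • Z w) 1 1 * (∑ w, v w • Z w) 3 3 - (∑ w, v w • Z w) 1 3 * (∑ w, v w • Z w) 3 1 +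
      (∑ w, v w • Z w) 2 2 * (∑ w, v w • Z w) 3 3 - (∑ w, v w • Z w) 2 3 * (∑ w, v w • Z w) 3 2 = 0) ∧
    ((∑ w, v w • Z w).submatrix ![0, 1, 3] ![0, 1, 3]).det +
      ((∑ w, v w • Z w).submatrix ![0, 2, 3] ![0, 2, 3]).det +
      ((∑ w, v w • Z w).submatrix ![1, 2, 3] ![1, 2, 3]).det =
        c * (v 0 * v 1 ^ 2 + v 1 * v 3 ^ 2 + v 2 ^ 3) ∧
    (∑ w, v w • Z w).det = 0 := by
  have key := coeff_eq_zero_of_forall 0 ((∑ w, v w • Z w) 3 3)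
    ((∑ w, v w • Z w) 0 0 * (∑ w, v w • Z w) 3 3 - (∑ w, v w • Z w) 0 3 * (∑ w, v w • Z w) 3 0 +
      (∑ w, v w • Z w) 1 1 * (∑ w, v w • Z w) 3 3 - (∑ w, v w • Z w) 1 3 * (∑ w, v w • Z w) 3 1 +
      (∑ w, v w • Z w) 2 2 * (∑ w, v w • Z w) 3 3 - (∑ w, v w • Z w) 2 3 * (∑ w, v w • Z w) 3 2)
    (((∑ w, v w • Z w).submatrix ![0, 1, 3] ![0, 1, 3]).det +
      ((∑ w, v w • Z w).submatrix ![0, 2, 3] ![0, 2, 3]).det +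
      ((∑ w, v w • Z w).submatrix ![1, 2, 3] ![1, 2, 3]).det -
        c * (v 0 * v 1 ^ 2 + v 1 * v 3 ^ 2 + v 2 ^ 3))
    (∑ w, v w • Z w).det (fun s => by
      have h := hP (s • v)
      rw [sum_smul_smul, det_diag_one_one_one_add_smul, eval_abvCubic] at h
      simp only [Pi.smul_apply, smul_eq_mul] at h
      linear_combination h)
  exact ⟨key.2.1, key.2.2.1, by linear_combination key.2.2.2.1, key.2.2.2.2⟩

/-- **Rank `3`, the sub-case `α = γ = 0` closed** (the step the printed proof omits, see the
module docstring): with column `3` of `Z` equal to `(z, y, t, 0)` and row `3` equal to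
`(β y, -β z, 0, 0)`, the identities on the planes `x = y = 0` (`f = z³`: coefficients of `z³`,
`z²t`, `zt²` of the cubic part and of `zt³`, `z²t²` of `det Z`) and `x = z = 0` (`f = y t²`:
coefficient of `y t²`) are inconsistent. [cite: AlperBogartVelasco2017, proof of Thm. 1.8 (r = 3)] -/
theorem four_false_of_rank_three_nf {Z : Fin 4 → Matrix (Fin 4) (Fin 4) K} {c : K} (hc : c ≠ 0)
    (hP : ∀ v : Fin 4 → K, (Matrix.diagonal ![(1 : K), 1, 1, 0] + ∑ w, v w • Z w).det =
      c * MvPolynomial.eval v (abvCubic K))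
    (h03 : ∀ w, Z w 0 3 = if w = 2 then 1 else 0) (h13 : ∀ w, Z w 1 3 = if w = 1 then 1 else 0)
    (h23 : ∀ w, Z w 2 3 = if w = 3 then 1 else 0) (h33 : ∀ w, Z w 3 3 = 0) {β : K}
    (h30 : ∀ w, Z w 3 0 = if w = 1 then β else 0) (h31 : ∀ w, Z w 3 1 = if w = 2 then -β else 0)
    (h32 : ∀ w, Z w 3 2 = 0) : False := by
  have hE := four_three_coeffs hP
  -- plane `x = y = 0`, points `(0, 0, 1, s)`: the cubic part equals `c`
  have k1 := coeff_eq_zero_of_forall (-β * Z 2 1 0 - c) (-β * (Z 2 1 2 + Z 3 1 0))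
    (-β * Z 3 1 2) 0 0 (fun s => by
      have h := (hE ![0, 0, 1, s]).2.2.1
      rw [sum_smul_four, Matrix.det_fin_three, Matrix.det_fin_three, Matrix.det_fin_three] at h
      simp [Matrix.submatrix_apply, h03, h13, h23, h33, h30, h31, h32] at h
      linear_combination h)
  -- plane `x = y = 0`: `det Z = 0`
  have k2 := coeff_eq_zero_of_forall (-β * (Z 2 1 0 * Z 2 2 2 - Z 2 1 2 * Z 2 2 0))
    (-β * (Z 2 0 0 * Z 2 1 2 - Z 2 0 2 * Z 2 1 0 + Z 2 1 0 * Z 3 2 2 - Z 2 1 2 * Z 3 2 0 -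
      Z 2 2 0 * Z 3 1 2 + Z 2 2 2 * Z 3 1 0))
    (-β * (Z 2 0 0 * Z 3 1 2 - Z 2 0 2 * Z 3 1 0 - Z 2 1 0 * Z 3 0 2 + Z 2 1 2 * Z 3 0 0 +
      Z 3 1 0 * Z 3 2 2 - Z 3 1 2 * Z 3 2 0))
    (-β * (Z 3 0 0 * Z 3 1 2 - Z 3 0 2 * Z 3 1 0)) 0 (fun s => by
      have h := (hE ![0, 0, 1, s]).2.2.2
      rw [sum_smul_four] at h
      simp [Matrix.det_succ_row_zero, Fin.sum_univ_succ, Fin.succAbove, h03, h13, h23, h33, h30,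
        h31, h32] at h
      linear_combination h)
  -- plane `x = z = 0`, points `(0, 1, 0, s)`: the cubic part equals `c s²`
  have k3 := coeff_eq_zero_of_forall (β * Z 1 0 1) (β * (Z 1 0 2 + Z 3 0 1)) (β * Z 3 0 2 - c)
    0 0 (fun s => by
      have h := (hE ![0, 1, 0, s]).2.2.1
      rw [sum_smul_four, Matrix.det_fin_three, Matrix.det_fin_three, Matrix.det_fin_three] at h
      simp [Matrix.submatrix_apply, h03, h13, h23, h33, h30, h31, h32] at h
      linear_combination h)
  obtain ⟨a0, a1, a2, -, -⟩ := k1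
  obtain ⟨-, -, b2, b3, -⟩ := k2
  obtain ⟨-, -, c2, -, -⟩ := k3
  -- the elimination
  have hβ : β * Z 3 0 2 = c := by linear_combination c2
  have hβ0 : β ≠ 0 := fun h => hc (by rw [← hβ, h, zero_mul])
  have e1 : Z 3 1 2 = 0 := by
    have : β * Z 3 1 2 = 0 := by linear_combination -a2
    exact (mul_eq_zero.1 this).resolve_left hβ0
  have e2 : Z 3 1 0 = 0 := by
    have : c * Z 3 1 0 = 0 := by
      rw [← hβ]; rw [e1] at b3; linear_combination b3
    exact (mul_eq_zero.1 this).resolve_left hc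
  have e3 : Z 2 1 2 = 0 := by
    have : β * Z 2 1 2 = 0 := by rw [e2] at a1; linear_combination -a1
    exact (mul_eq_zero.1 this).resolve_left hβ0
  have e4 : Z 2 1 0 = 0 := by
    have : c * Z 2 1 0 = 0 := by
      rw [← hβ]; rw [e1, e2, e3] at b2; linear_combination b2
    exact (mul_eq_zero.1 this).resolve_left hc
  apply hc
  rw [e4] at a0
  linear_combination -a0

/-- **Rank `3`, after the column normalisation `(Z₀₃, Z₁₃, Z₂₃) = (z, y, t)`** with `x`-free row
forms: the quadratic relation makes the row forms `S·(z, y, t)` with `S` antisymmetric (ABV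
p0006.txt:L19: "the matrix expressing `Z₁₂, Z₁₃, Z₁₄` in terms of `z, y, t` is necessarily
anti-symmetric … `Z₁₂ = αt + βy`, `Z₁₃ = -βz + γt`, `Z₁₄ = -γy - αz`"); the row of `L` then vanishes
along the line through `(s, -α, γ, β)`, where `f = s α² - α β² + γ³`, forcing `α = γ = 0` (this is
the printed "top row of `L` is `0` … `f` vanishes on this subspace" argument, which in fact disposes
of every case except `α = γ = 0`), and `four_false_of_rank_three_nf` finishes. [cite: AlperBogartVelasco2017, proof of Thm. 1.8 (r = 3)] -/
theorem four_false_of_rank_three_col {Z : Fin 4 → Matrix (Fin 4) (Fin 4) K} {c : K} (hc : c ≠ 0)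
    (hP : ∀ v : Fin 4 → K, (Matrix.diagonal ![(1 : K), 1, 1, 0] + ∑ w, v w • Z w).det =
      c * MvPolynomial.eval v (abvCubic K))
    (h03 : ∀ w, Z w 0 3 = if w = 2 then 1 else 0) (h13 : ∀ w, Z w 1 3 = if w = 1 then 1 else 0)
    (h23 : ∀ w, Z w 2 3 = if w = 3 then 1 else 0) (h33 : ∀ w, Z w 3 3 = 0)
    (hx : ∀ j, Z 0 3 j = 0) : False := by
  have hE := four_three_coeffs hP
  -- antisymmetry of the row forms in the basis `(z, y, t)`, from the quadratic relation at
  -- `e_y, e_z, e_t, e_y + e_z, e_y + e_t, e_z + e_t`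
  have q := fun v => (hE v).2.1
  have q1 := q ![0, 1, 0, 0]
  have q2 := q ![0, 0, 1, 0]
  have q3 := q ![0, 0, 0, 1]
  have q12 := q ![0, 1, 1, 0]
  have q13 := q ![0, 1, 0, 1]
  have q23 := q ![0, 0, 1, 1]
  simp only [sum_smul_four, Matrix.add_apply, Matrix.smul_apply, smul_eq_mul, h03, h13, h23, h33]
    at q1 q2 q3 q12 q13 q23
  simp at q1 q2 q3 q12 q13 q23
  -- `q1 : Z 1 3 1 = 0`, `q2 : Z 2 3 0 = 0`, `q3 : Z 3 3 2 = 0`, and the three polarised ones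
  set α := Z 3 3 0 with hα
  set β := Z 1 3 0 with hβ
  set γ := Z 3 3 1 with hγ
  have h231 : Z 2 3 1 = -β := by linear_combination -q12 - q1 - q2
  have h132 : Z 1 3 2 = -γ := by linear_combination -q13 - q1 - q3
  have h232 : Z 2 3 2 = -α := by linear_combination -q23 - q2 - q3
  -- the row of `L` vanishes along `(s, -α, γ, β)`
  have hline : ∀ s : K, s * α ^ 2 - α * β ^ 2 + γ ^ 3 = 0 := by
    intro s
    have hdet : (Matrix.diagonal ![(1 : K), 1, 1, 0] + ∑ w, (![s, -α, γ, β] : Fin 4 → K) w • Z w).det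
        = 0 := by
      refine Matrix.det_eq_zero_of_row_eq_zero 3 fun j => ?_
      rw [sum_smul_four]
      fin_cases j <;>
        simp [Matrix.add_apply, Matrix.smul_apply, hx, h33, q1, q2, q3, h231, h132, h232] <;> ring
    have h := hP ![s, -α, γ, β]
    rw [hdet, eval_abvCubic] at h
    simp at h
    rcases h with h' | h'
    · exact absurd h' hc
    · linear_combination h'
  have hα0 : α = 0 := by
    have : α ^ 2 = 0 := by linear_combination hline 1 - hline 0
    exact pow_eq_zero_iff (n := 2) (by norm_num) |>.1 this
  have hγ0 : γ = 0 := by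
    have : γ ^ 3 = 0 := by
      have h := hline 0
      rw [hα0] at h
      linear_combination h
    exact pow_eq_zero_iff (n := 3) (by norm_num) |>.1 this
  refine four_false_of_rank_three_nf hc hP h03 h13 h23 h33 (β := β) ?_ ?_ ?_
  · intro w
    fin_cases w
    · simpa using hx 0
    · simp [hβ]
    · simpa using q2
    · simpa using hα0
  · intro w
    fin_cases w
    · simpa using hx 1
    · simpa using q1
    · simpa using h231
    · simpa using hγ0
  · intro w
    fin_cases w
    · simpa using hx 2
    · simpa [hγ0] using h132
    · simpa [hα0] using h232
    · simpa using q3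

/-! #### Rank `3`: the reduction to the column normal form (ABV p0006.txt:L19–L22) -/

omit [CharZero K] in
/-- Additivity of a linear pencil in the point. [folklore] -/
private theorem sum_add_smul_smul {n : Type*} (Z : Fin 4 → Matrix n n K) (v u : Fin 4 → K)
    (s : K) : ∑ w, (v + s • u) w • Z w = ∑ w, v w • Z w + s • ∑ w, u w • Z w := by
  rw [← sum_smul_smul, ← Finset.sum_add_distrib]
  exact Finset.sum_congr rfl fun w _ => by rw [Pi.add_apply, add_smul]

omit [CharZero K] in
/-- Entries of a linear pencil as dot products. [folklore] -/
private theorem sum_smul_apply_eq {n : Type*} (Z : Fin 4 → Matrix n n K) (v : Fin 4 → K)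
    (i j : n) : (∑ w, v w • Z w) i j = (fun w => Z w i j) ⬝ᵥ v := by
  have h := pencil_apply_dot (0 : Matrix n n K) Z v i j
  rwa [zero_add, Matrix.zero_apply, zero_add] at h

/-- **Rank `3`: the common zeros of the row and column forms are singular points of the cone**
(ABV p0006.txt:L19–L20 with p0005.txt:L31: "`f ∈ I²` and all partial derivatives are in `I`.
Thus `V(I) ⊆ Sing(f)`", and "`V(f)` is singular along `y = z = t = 0`"): if the last row and
column of `Z(v)` vanish then `det L(v + s u) = s² · det B(s)` for a matrix `B(s)` affine in `s`
(conjugate by `diag(1,1,1,s)`), so the directional derivatives of `f` at `v` vanish, whence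
`v ∈ K·(1,0,0,0)`. [cite: AlperBogartVelasco2017, proof of Thm. 1.8 (r = 3)] -/
theorem four_three_sing {Z : Fin 4 → Matrix (Fin 4) (Fin 4) K} {c : K} (hc : c ≠ 0)
    (hP : ∀ v : Fin 4 → K, (Matrix.diagonal ![(1 : K), 1, 1, 0] + ∑ w, v w • Z w).det =
      c * MvPolynomial.eval v (abvCubic K))
    (h33 : ∀ w, Z w 3 3 = 0) {v : Fin 4 → K} (hcol : ∀ i, (∑ w, v w • Z w) i 3 = 0)
    (hrow : ∀ j, (∑ w, v w • Z w) 3 j = 0) : v 1 = 0 ∧ v 2 = 0 ∧ v 3 = 0 := by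
  haveI : Infinite K := Infinite.of_injective (Nat.cast : ℕ → K) Nat.cast_injective
  set A := Matrix.diagonal ![(1 : K), 1, 1, 0] + ∑ w, v w • Z w with hA
  have hA3 : ∀ i, A i 3 = 0 := fun i => by
    rw [hA, Matrix.add_apply, hcol, add_zero]
    fin_cases i <;> simp
  have h3A : ∀ j, A 3 j = 0 := fun j => by
    rw [hA, Matrix.add_apply, hrow, add_zero]
    fin_cases j <;> simp
  -- `f(v) = 0`
  have hfv : v 0 * v 1 ^ 2 + v 1 * v 3 ^ 2 + v 2 ^ 3 = 0 := by
    have h := hP v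
    rw [Matrix.det_eq_zero_of_row_eq_zero 3 h3A, eval_abvCubic] at h
    rcases mul_eq_zero.1 h.symm with h' | h'
    · exact absurd h' hc
    · exact h'
  -- the directional derivative in direction `u` vanishes
  have hdir : ∀ u : Fin 4 → K, u 0 * v 1 ^ 2 + u 1 * (2 * v 0 * v 1 + v 3 ^ 2) +
      u 2 * (3 * v 2 ^ 2) + u 3 * (2 * v 1 * v 3) = 0 := by
    intro u
    set M := ∑ w, u w • Z w with hM
    have hM33 : M 3 3 = 0 := by rw [hM, Matrix.sum_apply]; simp [h33]
    -- `A + s M = D (B₀ + s B₁) D` with `D = diag(1,1,1,s)`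
    let B₀ : Matrix (Fin 4) (Fin 4) K := Matrix.of fun i j => if i = 3 ∨ j = 3 then M i j else A i j
    let B₁ : Matrix (Fin 4) (Fin 4) K := Matrix.of fun i j => if i = 3 ∨ j = 3 then 0 else M i j
    have hfac : ∀ s : K, A + s • M =
        Matrix.diagonal ![(1 : K), 1, 1, s] * (B₀ + s • B₁) * Matrix.diagonal ![(1 : K), 1, 1, s] := by
      intro s
      ext i j
      rw [Matrix.mul_apply]
      simp only [Matrix.mul_apply, Matrix.diagonal_apply, Fin.sum_univ_four, Matrix.add_apply,
        Matrix.smul_apply, smul_eq_mul, B₀, B₁, Matrix.of_apply]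
      fin_cases i <;> fin_cases j <;> simp [hA3, h3A, hM33] <;> ring
    -- the polynomial `det (B₀ + X B₁)`
    let Bp : Matrix (Fin 4) (Fin 4) (Polynomial K) :=
      B₀.map Polynomial.C + (Polynomial.X : Polynomial K) • B₁.map Polynomial.C
    have hBp : ∀ s : K, (Polynomial.eval s) Bp.det = (B₀ + s • B₁).det := by
      intro s
      rw [← Polynomial.coe_evalRingHom, RingHom.map_det]
      congr 1
      ext i j
      simp [Bp, Matrix.map_apply]
      ring
    -- the identity `s² det B(s) = c f(v + s u)`
    have hid : ∀ s : K, s * (Polynomial.eval s Bp.det) * s =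
        c * (s * (u 0 * v 1 ^ 2 + u 1 * (2 * v 0 * v 1 + v 3 ^ 2) + u 2 * (3 * v 2 ^ 2) +
          u 3 * (2 * v 1 * v 3)) + s ^ 2 * (v 0 * u 1 ^ 2 + 2 * u 0 * u 1 * v 1 + v 1 * u 3 ^ 2 +
          2 * u 1 * u 3 * v 3 + 3 * v 2 * u 2 ^ 2) + s ^ 3 * (u 0 * u 1 ^ 2 + u 1 * u 3 ^ 2 +
          u 2 ^ 3)) := by
      intro s
      have h := hP (v + s • u)
      rw [sum_add_smul_smul, ← add_assoc, ← hA, ← hM, hfac s, Matrix.det_mul, Matrix.det_mul,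
        eval_abvCubic, ← hBp s] at h
      simp only [Matrix.det_diagonal, Fin.prod_univ_four, Matrix.cons_val_zero, Matrix.cons_val_one,
        Matrix.head_cons, Matrix.cons_val_two, Matrix.tail_cons, Matrix.cons_val_three, one_mul,
        Pi.add_apply, Pi.smul_apply, smul_eq_mul] at h
      linear_combination h + c * s ^ 0 * hfv
    -- divide by `s` and read off the constant coefficient
    let R : Polynomial K := Polynomial.X * Bp.det - Polynomial.C c *
      (Polynomial.C (u 0 * v 1 ^ 2 + u 1 * (2 * v 0 * v 1 + v 3 ^ 2) + u 2 * (3 * v 2 ^ 2) +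
        u 3 * (2 * v 1 * v 3)) + Polynomial.C (v 0 * u 1 ^ 2 + 2 * u 0 * u 1 * v 1 +
        v 1 * u 3 ^ 2 + 2 * u 1 * u 3 * v 3 + 3 * v 2 * u 2 ^ 2) * Polynomial.X +
        Polynomial.C (u 0 * u 1 ^ 2 + u 1 * u 3 ^ 2 + u 2 ^ 3) * Polynomial.X ^ 2)
    have hR : ∀ s : K, s ≠ 0 → R.IsRoot s := by
      intro s hs
      simp only [R, Polynomial.IsRoot, Polynomial.eval_sub, Polynomial.eval_mul, Polynomial.eval_X,
        Polynomial.eval_C, Polynomial.eval_add, Polynomial.eval_pow]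
      have h := hid s
      apply mul_left_cancel₀ hs
      linear_combination h
    have hR0 : R = 0 := by
      refine Polynomial.eq_zero_of_infinite_isRoot R ?_
      refine ((Set.finite_singleton (0 : K)).infinite_compl).mono fun s hs => ?_
      exact hR s (by simpa using hs)
    have hcoeff := congrArg (Polynomial.coeff · 0) hR0
    simp only [R, Polynomial.coeff_sub, Polynomial.coeff_zero, Polynomial.mul_coeff_zero,
      Polynomial.coeff_X_zero, zero_mul, zero_sub, neg_eq_zero, Polynomial.coeff_C_zero,
      Polynomial.coeff_add, Polynomial.coeff_X_pow, mul_zero, add_zero] at hcoeff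
    simpa [hc] using hcoeff
  have h1 : v 1 = 0 := by
    have h := hdir (Pi.single 0 1)
    simp at h
    exact h
  have h3 : v 3 = 0 := by
    have h := hdir (Pi.single 1 1)
    simp [h1] at h
    exact h
  have h2 : v 2 = 0 := by
    have h := hdir (Pi.single 2 1)
    simp at h
    exact h
  exact ⟨h1, h2, h3⟩

/-- **Rank `3`: if the (`x`-free) column forms are linearly dependent, they involve only `y, z`**
(ABV p0006.txt:L20–L21: "otherwise, as `y = z = 0` is the unique line in the cubic surface, both
spans would be equal to `⟨y, z⟩`"): a dependency gives a plane through `(1,0,0,0)` on which the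
last column of `L`, hence `f`, vanishes; by the unique line it is `{y = z = 0}`, so it contains
`(0,0,0,1)` and the `t`-coefficients vanish. [cite: AlperBogartVelasco2017, proof of Thm. 1.8 (r = 3)] -/
theorem four_three_col_tcoeff {Z : Fin 4 → Matrix (Fin 4) (Fin 4) K} {c : K} (hc : c ≠ 0)
    (hP : ∀ v : Fin 4 → K, (Matrix.diagonal ![(1 : K), 1, 1, 0] + ∑ w, v w • Z w).det =
      c * MvPolynomial.eval v (abvCubic K))
    (h33 : ∀ w, Z w 3 3 = 0) (hx : ∀ i, Z 0 i 3 = 0)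
    (hdet : (!![Z 1 0 3, Z 2 0 3, Z 3 0 3; Z 1 1 3, Z 2 1 3, Z 3 1 3; Z 1 2 3, Z 2 2 3, Z 3 2 3] :
      Matrix (Fin 3) (Fin 3) K).det = 0) : ∀ i, Z 3 i 3 = 0 := by
  obtain ⟨u, hu0, hu⟩ := Matrix.exists_mulVec_eq_zero_iff.2 hdet
  have hu' : ∀ i : Fin 3, (!![Z 1 0 3, Z 2 0 3, Z 3 0 3; Z 1 1 3, Z 2 1 3, Z 3 1 3;
      Z 1 2 3, Z 2 2 3, Z 3 2 3] : Matrix (Fin 3) (Fin 3) K).mulVec u i = 0 := fun i => by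
    rw [hu]; rfl
  have e0 := hu' 0
  have e1 := hu' 1
  have e2 := hu' 2
  simp [Matrix.mulVec, dotProduct, Fin.sum_univ_three] at e0 e1 e2
  -- the plane through `e₀` and `(0, u)`
  let uh : Fin 4 → K := ![0, u 0, u 1, u 2]
  let e₀ : Fin 4 → K := Pi.single 0 1
  have hcol : ∀ (a b : K) (i : Fin 4), (fun w => Z w i 3) ⬝ᵥ (a • e₀ + b • uh) = 0 := by
    intro a b i
    rw [dotProduct_add, dotProduct_smul, dotProduct_smul, dotProduct_single, smul_eq_mul,
      smul_eq_mul, mul_one, hx, mul_zero, zero_add]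
    fin_cases i
    · simp [dotProduct, Fin.sum_univ_four, uh, hx]; right; linear_combination e0
    · simp [dotProduct, Fin.sum_univ_four, uh, hx]; right; linear_combination e1
    · simp [dotProduct, Fin.sum_univ_four, uh, hx]; right; linear_combination e2
    · simp [dotProduct, uh, h33]
  have hf : ∀ w ∈ Submodule.span K (Set.range ![e₀, uh]),
      w 0 * w 1 ^ 2 + w 1 * w 3 ^ 2 + w 2 ^ 3 = 0 := by
    intro w hw
    obtain ⟨cf, rfl⟩ := Submodule.mem_span_range_iff_exists_fun K |>.1 hw
    rw [Fin.sum_univ_two]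
    simp only [Matrix.cons_val_zero, Matrix.cons_val_one]
    have hdet0 : (Matrix.diagonal ![(1 : K), 1, 1, 0] +
        ∑ w, (cf 0 • e₀ + cf 1 • uh) w • Z w).det = 0 := by
      refine Matrix.det_eq_zero_of_column_eq_zero 3 fun i => ?_
      rw [pencil_apply_dot, hcol]
      fin_cases i <;> simp
    have h := hP (cf 0 • e₀ + cf 1 • uh)
    rw [hdet0, eval_abvCubic] at h
    rcases mul_eq_zero.1 h.symm with h' | h'
    · exact absurd h' hc
    · exact h'
  have hli : LinearIndependent K ![e₀, uh] := by
    rw [LinearIndependent.pair_iff]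
    intro a b hab
    have h0 := congrFun hab 0
    have h1 := congrFun hab 1
    have h2 := congrFun hab 2
    have h3 := congrFun hab 3
    simp [e₀, uh] at h0 h1 h2 h3
    subst h0
    refine ⟨rfl, ?_⟩
    by_contra hb
    apply hu0
    funext m
    fin_cases m
    · simpa [hb] using h1
    · simpa [hb] using h2
    · simpa [hb] using h3
  have hW : 2 ≤ finrank K (Submodule.span K (Set.range ![e₀, uh])) := by
    rw [finrank_span_eq_card hli, Fintype.card_fin]
  have key := uniqueLine hW hf uh (Submodule.subset_span ⟨1, rfl⟩)
  simp [uh] at key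
  obtain ⟨hu0', hu1'⟩ := key
  have hu2 : u 2 ≠ 0 := fun h => hu0 (by
    funext m; fin_cases m
    · exact hu0'
    · exact hu1'
    · exact h)
  rw [hu0', hu1'] at e0 e1 e2
  simp only [mul_zero, zero_add] at e0 e1 e2
  intro i
  fin_cases i
  · exact (mul_eq_zero.1 e0).resolve_right hu2
  · exact (mul_eq_zero.1 e1).resolve_right hu2
  · exact (mul_eq_zero.1 e2).resolve_right hu2
  · exact h33 3

/-- **Rank `3`: bringing independent `x`-free column forms to `(z, y, t)`** (ABV p0006.txt:L21–22:
"after replacing `L` by `P⁻¹ L P` … we can assume that `Z₂₁ = z`, `Z₃₁ = y` and `Z₄₁ = t`"):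
conjugation by `diag(T·C⁻¹, 1)`, `C` the coefficient matrix of the column forms, `T` the
permutation `y ↔ z`; then `four_false_of_rank_three_col` applies. [cite: AlperBogartVelasco2017, proof of Thm. 1.8 (r = 3)] -/
theorem four_false_of_rank_three_colbasis {Z : Fin 4 → Matrix (Fin 4) (Fin 4) K} {c : K}
    (hc : c ≠ 0)
    (hP : ∀ v : Fin 4 → K, (Matrix.diagonal ![(1 : K), 1, 1, 0] + ∑ w, v w • Z w).det =
      c * MvPolynomial.eval v (abvCubic K))
    (h33 : ∀ w, Z w 3 3 = 0) (hx1 : ∀ j, Z 0 3 j = 0) (hx2 : ∀ j, Z 0 j 3 = 0)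
    (hdet : (!![Z 1 0 3, Z 2 0 3, Z 3 0 3; Z 1 1 3, Z 2 1 3, Z 3 1 3; Z 1 2 3, Z 2 2 3, Z 3 2 3] :
      Matrix (Fin 3) (Fin 3) K).det ≠ 0) : False := by
  set Cm : Matrix (Fin 3) (Fin 3) K := !![Z 1 0 3, Z 2 0 3, Z 3 0 3; Z 1 1 3, Z 2 1 3, Z 3 1 3;
    Z 1 2 3, Z 2 2 3, Z 3 2 3] with hCm
  let Tm : Matrix (Fin 3) (Fin 3) K := !![0, 1, 0; 1, 0, 0; 0, 0, 1]
  have hTm : Tm * Tm = 1 := by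
    ext i j
    fin_cases i <;> fin_cases j <;>
      simp only [Matrix.mul_apply, Fin.sum_univ_three, Matrix.one_apply] <;> simp [Tm]
  let Pb : Matrix (Fin 3) (Fin 3) K := Tm * Cm⁻¹
  let Qb : Matrix (Fin 3) (Fin 3) K := Cm * Tm
  have hCinv : Cm⁻¹ * Cm = 1 := Matrix.nonsing_inv_mul Cm (isUnit_iff_ne_zero.2 hdet)
  have hPbCm : Pb * Cm = Tm := by
    show Tm * Cm⁻¹ * Cm = Tm
    rw [Matrix.mul_assoc, hCinv, Matrix.mul_one]
  have hPbQb : Pb * Qb = 1 := by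
    show Tm * Cm⁻¹ * (Cm * Tm) = 1
    rw [Matrix.mul_assoc, ← Matrix.mul_assoc Cm⁻¹, hCinv, Matrix.one_mul, hTm]
  have E1 : ∀ a b : Fin 3, Pb a 0 * Qb 0 b + Pb a 1 * Qb 1 b + Pb a 2 * Qb 2 b =
      if a = b then (1 : K) else 0 := fun a b => by
    rw [← Matrix.one_apply, ← hPbQb, Matrix.mul_apply, Fin.sum_univ_three]
  have EC1 : ∀ a : Fin 3, Pb a 0 * Z 1 0 3 + Pb a 1 * Z 1 1 3 + Pb a 2 * Z 1 2 3 = Tm a 0 :=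
    fun a => by rw [← hPbCm, Matrix.mul_apply, Fin.sum_univ_three]; simp [hCm]
  have EC2 : ∀ a : Fin 3, Pb a 0 * Z 2 0 3 + Pb a 1 * Z 2 1 3 + Pb a 2 * Z 2 2 3 = Tm a 1 :=
    fun a => by rw [← hPbCm, Matrix.mul_apply, Fin.sum_univ_three]; simp [hCm]
  have EC3 : ∀ a : Fin 3, Pb a 0 * Z 3 0 3 + Pb a 1 * Z 3 1 3 + Pb a 2 * Z 3 2 3 = Tm a 2 :=
    fun a => by rw [← hPbCm, Matrix.mul_apply, Fin.sum_univ_three]; simp [hCm]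
  -- the block matrices `diag(Pb, 1)`, `diag(Qb, 1)`
  let P : Matrix (Fin 4) (Fin 4) K := !![Pb 0 0, Pb 0 1, Pb 0 2, 0; Pb 1 0, Pb 1 1, Pb 1 2, 0;
    Pb 2 0, Pb 2 1, Pb 2 2, 0; 0, 0, 0, 1]
  let Q : Matrix (Fin 4) (Fin 4) K := !![Qb 0 0, Qb 0 1, Qb 0 2, 0; Qb 1 0, Qb 1 1, Qb 1 2, 0;
    Qb 2 0, Qb 2 1, Qb 2 2, 0; 0, 0, 0, 1]
  have hPQ : P * Q = 1 := by
    ext i j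
    fin_cases i <;> fin_cases j <;>
      simp only [Matrix.mul_apply, Fin.sum_univ_four, Matrix.one_apply] <;> simp [P, Q, E1]
  have hJ : P * Matrix.diagonal ![(1 : K), 1, 1, 0] * Q = Matrix.diagonal ![(1 : K), 1, 1, 0] := by
    ext i j
    fin_cases i <;> fin_cases j <;>
      simp only [Matrix.mul_apply, Fin.sum_univ_four, Matrix.diagonal_apply] <;> simp [P, Q, E1]
  have hP' := pencil_det_conj P Q hPQ hJ hP
  have ecol : ∀ w (i : Fin 4), (P * Z w * Q) i 3 =
      P i 0 * Z w 0 3 + P i 1 * Z w 1 3 + P i 2 * Z w 2 3 + P i 3 * Z w 3 3 := by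
    intro w i
    simp only [Matrix.mul_apply, Fin.sum_univ_four]
    simp [Q]
  refine four_false_of_rank_three_col (Z := fun w => P * Z w * Q) hc hP' ?_ ?_ ?_ ?_ ?_
  · intro w
    show (P * Z w * Q) 0 3 = _
    rw [ecol]
    fin_cases w <;> simp [P, hx2, h33, EC1, EC2, EC3, Tm]
  · intro w
    show (P * Z w * Q) 1 3 = _
    rw [ecol]
    fin_cases w <;> simp [P, hx2, h33, EC1, EC2, EC3, Tm]
  · intro w
    show (P * Z w * Q) 2 3 = _
    rw [ecol]
    fin_cases w <;> simp [P, hx2, h33, EC1, EC2, EC3, Tm]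
  · intro w
    show (P * Z w * Q) 3 3 = 0
    rw [ecol]
    simp [P, h33]
  · intro j
    show (P * Z 0 * Q) 3 j = 0
    simp only [Matrix.mul_apply, Fin.sum_univ_four]
    simp [P, hx1]

/-- **Rank `3` of `L(0)` is impossible** (ABV p0006.txt:L19–L47, with the sub-case `α = γ = 0`
supplied): `Z₃₃ = 0` and `Σ_j Z_{3j} Z_{j3} = 0`; the common zeros of the six forms are singular
points of the cone (`four_three_sing`), so lie on `K·(1,0,0,0)`, while the forms span an isotropic
subspace of the split quadric, of dimension `≤ 3` (`finrank_add_one_le_card_of_isotropic`); hence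
the forms are `x`-free and span `⟨y, z, t⟩`, the row or the column forms are independent
(`four_three_col_tcoeff`, else all `t`-coefficients vanish), and after a transposition
`four_false_of_rank_three_colbasis` applies. [cite: AlperBogartVelasco2017, proof of Thm. 1.8 (r = 3)] -/
theorem four_false_of_rank_three {Z : Fin 4 → Matrix (Fin 4) (Fin 4) K} {c : K} (hc : c ≠ 0)
    (hP : ∀ v : Fin 4 → K, (Matrix.diagonal ![(1 : K), 1, 1, 0] + ∑ w, v w • Z w).det =
      c * MvPolynomial.eval v (abvCubic K)) : False := by
  have hE := four_three_coeffs hP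
  -- `Z₃₃ = 0`
  have h33 : ∀ w, Z w 3 3 = 0 := fun w => by
    have h := (hE (Pi.single w 1)).1
    rwa [sum_smul_apply_eq, dotProduct_single, mul_one] at h
  -- the quadratic relation, as products of linear forms
  have hq : ∀ v : Fin 4 → K,
      ((fun w => Z w 3 0) ⬝ᵥ v) * ((fun w => Z w 0 3) ⬝ᵥ v) +
      ((fun w => Z w 3 1) ⬝ᵥ v) * ((fun w => Z w 1 3) ⬝ᵥ v) +
      ((fun w => Z w 3 2) ⬝ᵥ v) * ((fun w => Z w 2 3) ⬝ᵥ v) = 0 := by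
    intro v
    have h := (hE v).2.1
    have h0 := (hE v).1
    simp only [sum_smul_apply_eq] at h h0
    rw [h0] at h
    linear_combination -h
  -- the linear map `v ↦ (row forms, column forms)`
  let G : (Fin 4 → K) →ₗ[K] (Fin 4 → K) × (Fin 4 → K) :=
    LinearMap.prod (Matrix.mulVecLin (Matrix.of fun j w => Z w 3 j))
      (Matrix.mulVecLin (Matrix.of fun j w => Z w j 3))
  have hG1 : ∀ v j, (G v).1 j = (fun w => Z w 3 j) ⬝ᵥ v := fun v j => rfl
  have hG2 : ∀ v j, (G v).2 j = (fun w => Z w j 3) ⬝ᵥ v := fun v j => rfl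
  have outer : ∀ a b : Fin 4 → K, a ⬝ᵥ b = a 0 * b 0 + a 1 * b 1 + a 2 * b 2 + a 3 * b 3 :=
    fun a b => by rw [dotProduct, Fin.sum_univ_four]
  have hiso : ∀ z ∈ LinearMap.range G, ∀ z' ∈ LinearMap.range G,
      z.1 ⬝ᵥ z'.2 + z'.1 ⬝ᵥ z.2 = 0 := by
    rintro _ ⟨v, rfl⟩ _ ⟨v', rfl⟩
    rw [outer (G v).1, outer (G v').1]
    simp only [hG1, hG2]
    have h1 := hq v
    have h2 := hq v'
    have h3 := hq (v + v')
    simp only [dotProduct_add] at h3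
    have e33 : ∀ u : Fin 4 → K, (fun w => Z w 3 3) ⬝ᵥ u = 0 := fun u => by
      simp [dotProduct, h33]
    rw [e33, e33]
    linear_combination h3 - h1 - h2
  have h0 : ∀ z ∈ LinearMap.range G, z.1 3 = 0 ∧ z.2 3 = 0 := by
    rintro _ ⟨v, rfl⟩
    rw [hG1, hG2]
    constructor <;> simp [dotProduct, h33]
  have hrange := finrank_add_one_le_card_of_isotropic (LinearMap.range G) 3 hiso h0
  rw [Fintype.card_fin] at hrange
  -- the kernel lies on the line `K·e₀`
  let e₀ : Fin 4 → K := Pi.single 0 1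
  have hker : LinearMap.ker G ≤ K ∙ e₀ := by
    intro v hv
    rw [LinearMap.mem_ker] at hv
    have hv1 : ∀ j, (fun w => Z w 3 j) ⬝ᵥ v = 0 := fun j => by rw [← hG1, hv]; rfl
    have hv2 : ∀ j, (fun w => Z w j 3) ⬝ᵥ v = 0 := fun j => by rw [← hG2, hv]; rfl
    obtain ⟨h1, h2, h3⟩ := four_three_sing hc hP h33 (v := v)
      (fun i => by rw [sum_smul_apply_eq, hv2]) (fun j => by rw [sum_smul_apply_eq, hv1])
    rw [Submodule.mem_span_singleton]
    refine ⟨v 0, ?_⟩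
    funext i
    fin_cases i <;> simp [e₀, h1, h2, h3]
  have hfr : finrank K (LinearMap.range G) + finrank K (LinearMap.ker G) = 4 := by
    have h := LinearMap.finrank_range_add_finrank_ker G
    rwa [Module.finrank_fintype_fun_eq_card, Fintype.card_fin] at h
  have he₀ : e₀ ≠ 0 := fun h => by simpa [e₀] using congrFun h 0
  have hker1 : finrank K (LinearMap.ker G) ≤ 1 := by
    have h := Submodule.finrank_mono hker
    rwa [finrank_span_singleton he₀] at h
  have hkereq : LinearMap.ker G = K ∙ e₀ :=
    Submodule.eq_of_le_of_finrank_eq hker (by rw [finrank_span_singleton he₀]; omega)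
  -- hence the forms are `x`-free
  have hx : ∀ j, Z 0 3 j = 0 ∧ Z 0 j 3 = 0 := by
    have hmem : e₀ ∈ LinearMap.ker G := by
      rw [hkereq]; exact Submodule.mem_span_singleton_self e₀
    rw [LinearMap.mem_ker] at hmem
    intro j
    have h1 := congrFun (congrArg Prod.fst hmem) j
    have h2 := congrFun (congrArg Prod.snd hmem) j
    rw [hG1] at h1
    rw [hG2] at h2
    simp only [e₀, dotProduct_single, mul_one, Prod.fst_zero, Prod.snd_zero, Pi.zero_apply] at h1 h2
    exact ⟨h1, h2⟩
  -- and the `t`-coefficients do not all vanish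
  let e₃ : Fin 4 → K := Pi.single 3 1
  have ht : ¬ ((∀ j, Z 3 3 j = 0) ∧ (∀ j, Z 3 j 3 = 0)) := by
    rintro ⟨ht1, ht2⟩
    have hmem : e₃ ∈ LinearMap.ker G := by
      rw [LinearMap.mem_ker]
      refine Prod.ext (funext fun j => ?_) (funext fun j => ?_)
      · rw [hG1]; simp [e₃, ht1]
      · rw [hG2]; simp [e₃, ht2]
    rw [hkereq, Submodule.mem_span_singleton] at hmem
    obtain ⟨a, ha⟩ := hmem
    have h := congrFun ha 3
    simp [e₀, e₃] at h
  -- symmetry of `J` under transposition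
  have hJt : (Matrix.diagonal ![(1 : K), 1, 1, 0])ᵀ = Matrix.diagonal ![(1 : K), 1, 1, 0] :=
    Matrix.diagonal_transpose _
  have hPt := pencil_det_transpose hJt hP
  -- dichotomy on the coefficient matrices of the column and row forms
  by_cases hC : (!![Z 1 0 3, Z 2 0 3, Z 3 0 3; Z 1 1 3, Z 2 1 3, Z 3 1 3; Z 1 2 3, Z 2 2 3, Z 3 2 3] :
      Matrix (Fin 3) (Fin 3) K).det = 0
  · by_cases hR : (!![Z 1 3 0, Z 2 3 0, Z 3 3 0; Z 1 3 1, Z 2 3 1, Z 3 3 1; Z 1 3 2, Z 2 3 2,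
        Z 3 3 2] : Matrix (Fin 3) (Fin 3) K).det = 0
    · refine ht ⟨fun j => ?_, four_three_col_tcoeff hc hP h33 (fun i => (hx i).2) hC⟩
      have h := four_three_col_tcoeff (Z := fun w => (Z w)ᵀ) hc hPt (fun w => by simp [h33])
        (fun i => by simpa using (hx i).1) (by simpa using hR) j
      simpa using h
    · exact four_false_of_rank_three_colbasis (Z := fun w => (Z w)ᵀ) hc hPt (fun w => by simp [h33])
        (fun j => by simpa using (hx j).2) (fun j => by simpa using (hx j).1) (by simpa using hR)
  · exact four_false_of_rank_three_colbasis hc hP h33 (fun j => (hx j).1) (fun j => (hx j).2) hC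

end FourThree

/-! ### Assembly: `dc(x y² + y t² + z³) = 5` (ABV Thm. 1.8) -/

section Assembly

variable {K : Type*} [Field K]

/-- `fromBlocks 1 0 0 0` on `Fin 1 ⊕ Fin 3` is `diag(1,0,0,0)` reindexed. [folklore] -/
private theorem fromBlocks_one_three :
    (Matrix.fromBlocks 1 0 0 0 : Matrix (Fin 1 ⊕ Fin 3) (Fin 1 ⊕ Fin 3) K) =
      (Matrix.diagonal ![(1 : K), 0, 0, 0]).submatrix finSumFinEquiv finSumFinEquiv := by
  ext (i | i) (j | j) <;> fin_cases i <;> fin_cases j <;>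
    simp [Matrix.fromBlocks, finSumFinEquiv, Fin.castAdd, Fin.natAdd]

/-- `fromBlocks 1 0 0 0` on `Fin 2 ⊕ Fin 2` is `diag(1,1,0,0)` reindexed. [folklore] -/
private theorem fromBlocks_two_two :
    (Matrix.fromBlocks 1 0 0 0 : Matrix (Fin 2 ⊕ Fin 2) (Fin 2 ⊕ Fin 2) K) =
      (Matrix.diagonal ![(1 : K), 1, 0, 0]).submatrix finSumFinEquiv finSumFinEquiv := by
  ext (i | i) (j | j) <;> fin_cases i <;> fin_cases j <;>
    simp [Matrix.fromBlocks, finSumFinEquiv, Fin.castAdd, Fin.natAdd]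

/-- `fromBlocks 1 0 0 0` on `Fin 3 ⊕ Fin 1` is `diag(1,1,1,0)` reindexed. [folklore] -/
private theorem fromBlocks_three_one :
    (Matrix.fromBlocks 1 0 0 0 : Matrix (Fin 3 ⊕ Fin 1) (Fin 3 ⊕ Fin 1) K) =
      (Matrix.diagonal ![(1 : K), 1, 1, 0]).submatrix finSumFinEquiv finSumFinEquiv := by
  ext (i | i) (j | j) <;> fin_cases i <;> fin_cases j <;>
    simp [Matrix.fromBlocks, finSumFinEquiv, Fin.castAdd, Fin.natAdd]

/-- `fromBlocks 1 0 0 0` on `Fin 0 ⊕ Fin 4` is `0`. [folklore] -/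
private theorem fromBlocks_zero_four :
    (Matrix.fromBlocks 1 0 0 0 : Matrix (Fin 0 ⊕ Fin 4) (Fin 0 ⊕ Fin 4) K) = 0 := by
  ext (i | i) (j | j)
  · exact i.elim0
  · exact i.elim0
  · exact j.elim0
  · simp

/-- `fromBlocks 1 0 0 0` on `Fin 4 ⊕ Fin 0` is `1`. [folklore] -/
private theorem fromBlocks_four_zero :
    (Matrix.fromBlocks 1 0 0 0 : Matrix (Fin 4 ⊕ Fin 0) (Fin 4 ⊕ Fin 0) K) = 1 := by
  ext (i | i) (j | j)
  · simp [Matrix.one_apply]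
  · exact j.elim0
  · exact i.elim0
  · exact i.elim0

variable [CharZero K]

/-- **No affine `4 × 4` determinantal expression of `c · (x y² + y t² + z³)`, `c ≠ 0`** — the
rank dispatch of ABV p0006.txt:L1–L2 ("`L = J + Z` … `J` the matrix of rank `r` … each
possibility for the rank `r` yields a contradiction"): bring `L(0)` to rank normal form by
`G · (−) · H` and a reindexing (`Matrix.exists_rank_normal_form`), then `r = 0, 1, 2, 3, 4` are
`four_false_of_rank_zero/one/two/three/four`. [cite: AlperBogartVelasco2017, Thm. 1.8 (proof, dc > 4)] -/
theorem four_false_affine {B : Matrix (Fin 4) (Fin 4) (MvPolynomial (Fin 4) K)}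
    (hB1 : ∀ i j, (B i j).totalDegree ≤ 1) {c : K} (hc : c ≠ 0)
    (hdet : B.det = C c * abvCubic K) : False := by
  have hP := det_pencil_of_det_eq hB1 hdet
  obtain ⟨G, H, e, hG, hH, hGH⟩ := exists_mul_mul_eq_fromBlocks (constPart B)
  have hr : (constPart B).rank ≤ 4 := by simpa using Matrix.rank_le_width (constPart B)
  have hc' : G.det * H.det * c ≠ 0 := mul_ne_zero (mul_ne_zero hG.ne_zero hH.ne_zero) hc
  -- the transported pencil, for any reindexing `σ`
  have hP' : ∀ σ : Fin 4 ≃ Fin 4, ∀ v : Fin 4 → K,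
      ((G * constPart B * H).submatrix σ σ +
        ∑ w, v w • (G * LRPencil.coeffMat B w * H).submatrix σ σ).det =
        (G.det * H.det * c) * MvPolynomial.eval v (abvCubic K) := by
    intro σ v
    have h : (G * constPart B * H).submatrix σ σ +
        ∑ w, v w • (G * LRPencil.coeffMat B w * H).submatrix σ σ =
        (G * (constPart B + ∑ w, v w • LRPencil.coeffMat B w) * H).submatrix σ σ := by
      rw [Matrix.mul_add, Matrix.add_mul, mul_sum_smul_mul]
      ext i j
      simp [Matrix.sum_apply]
    rw [h, Matrix.det_submatrix_equiv_self, Matrix.det_mul, Matrix.det_mul, hP v, eval_abvCubic]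
    ring
  revert e hr
  generalize (constPart B).rank = r
  intro e hGH hr
  interval_cases r
  · -- rank 0
    refine four_false_of_rank_zero hc'
      (Z := fun w => (G * LRPencil.coeffMat B w * H).submatrix (Equiv.refl _) (Equiv.refl _))
      fun v => ?_
    have h := hP' (Equiv.refl _) v
    rw [hGH, fromBlocks_zero_four] at h
    simpa only [Matrix.submatrix_zero, zero_add, Pi.zero_apply] using h
  · -- rank 1
    let σ : Fin 4 ≃ Fin 4 := (finSumFinEquiv (m := 1) (n := 3)).symm.trans e.symm
    refine four_false_of_rank_one hc' (Z := fun w => (G * LRPencil.coeffMat B w * H).submatrix σ σ)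
      fun v => ?_
    have hJ : (G * constPart B * H).submatrix σ σ = Matrix.diagonal ![(1 : K), 0, 0, 0] := by
      rw [hGH, fromBlocks_one_three, Matrix.submatrix_submatrix, Matrix.submatrix_submatrix]
      have hcomp : ⇑finSumFinEquiv ∘ ⇑e ∘ ⇑σ = id := by
        funext i
        simp [σ]
      rw [hcomp, Matrix.submatrix_id_id]
    have h := hP' σ v
    rwa [hJ] at h
  · -- rank 2
    let σ : Fin 4 ≃ Fin 4 := (finSumFinEquiv (m := 2) (n := 2)).symm.trans e.symm
    refine four_false_of_rank_two hc' (Z := fun w => (G * LRPencil.coeffMat B w * H).submatrix σ σ)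
      fun v => ?_
    have hJ : (G * constPart B * H).submatrix σ σ = Matrix.diagonal ![(1 : K), 1, 0, 0] := by
      rw [hGH, fromBlocks_two_two, Matrix.submatrix_submatrix, Matrix.submatrix_submatrix]
      have hcomp : ⇑finSumFinEquiv ∘ ⇑e ∘ ⇑σ = id := by
        funext i
        simp [σ]
      rw [hcomp, Matrix.submatrix_id_id]
    have h := hP' σ v
    rwa [hJ] at h
  · -- rank 3
    let σ : Fin 4 ≃ Fin 4 := (finSumFinEquiv (m := 3) (n := 1)).symm.trans e.symm
    refine four_false_of_rank_three hc'
      (Z := fun w => (G * LRPencil.coeffMat B w * H).submatrix σ σ) fun v => ?_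
    have hJ : (G * constPart B * H).submatrix σ σ = Matrix.diagonal ![(1 : K), 1, 1, 0] := by
      rw [hGH, fromBlocks_three_one, Matrix.submatrix_submatrix, Matrix.submatrix_submatrix]
      have hcomp : ⇑finSumFinEquiv ∘ ⇑e ∘ ⇑σ = id := by
        funext i
        simp [σ]
      rw [hcomp, Matrix.submatrix_id_id]
    have h := hP' σ v
    rwa [hJ] at h
  · -- rank 4
    refine four_false_of_rank_four (c := G.det * H.det * c)
      (Z := fun w => (G * LRPencil.coeffMat B w * H).submatrix (Equiv.refl _) (Equiv.refl _))
      fun v => ?_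
    have hJ : (G * constPart B * H).submatrix (Equiv.refl (Fin 4)) (Equiv.refl (Fin 4)) = 1 := by
      rw [hGH, fromBlocks_four_zero, Matrix.submatrix_one_equiv, Matrix.submatrix_one_equiv]
    have h := hP' (Equiv.refl _) v
    rwa [hJ] at h

/-- **`dc(x y² + y t² + z³) > 4`** (ABV p0006.txt:L47: "We have therefore established that
`dc(f) > 4`"): no affine determinantal expression of size `4`, over a field of characteristic `0`.
[cite: AlperBogartVelasco2017, Thm. 1.8 (proof, dc > 4)] -/
theorem not_hasDetRepr_abvCubic_four : ¬ HasDetRepr (abvCubic K) 4 := by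
  rintro ⟨B, hB1, hdet⟩
  exact four_false_affine hB1 one_ne_zero (by rw [hdet, map_one, one_mul])

/-- **`5 ≤ dc(x y² + y t² + z³)`**: from `dc > 4` and `HasDetRepr f m ↔ dc f ≤ m`
(`hasDetRepr_iff_determinantalComplexity_le_holds`). [cite: AlperBogartVelasco2017, Thm. 1.8] -/
theorem five_le_determinantalComplexity_abvCubic : 5 ≤ determinantalComplexity (abvCubic K) := by
  by_contra h
  exact not_hasDetRepr_abvCubic_four
    ((hasDetRepr_iff_determinantalComplexity_le_holds (abvCubic K) 4).2 (by omega))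

/-- **ABV Thm. 1.8**: `dc(x y² + y t² + z³) = 5` over a field of characteristic `0`
(`determinantalComplexity_abvCubic_le_five` and `five_le_determinantalComplexity_abvCubic`).
[cite: AlperBogartVelasco2017, Thm. 1.8] -/
theorem determinantalComplexity_abvCubic : determinantalComplexity (abvCubic K) = 5 :=
  le_antisymm (determinantalComplexity_abvCubic_le_five K) five_le_determinantalComplexity_abvCubic

end Assembly

/-- **Discharge of the named fact `alperBogartVelasco2017_thm_1_8`** (ABV, Found. Comput. Math. 17
(2017), Thm. 1.8: the cubic surface `x y² + y t² + z³` has determinantal complexity `5` over any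
field of characteristic `0`). The upper bound is the printed `5 × 5` matrix
(`determinantalComplexity_abvCubic_le_five`); the lower bound is `not_hasDetRepr_abvCubic_three`
(Brundu–Logar's `dc > 3`, re-proved) and `four_false_affine` (the rank analysis of p0006, with the
omitted sub-case `α = γ = 0` of `r = 3` closed in `four_false_of_rank_three_nf`). [cite: AlperBogartVelasco2017, Thm. 1.8] -/
theorem _root_.Literature.Computability.AlgebraicComplexity.alperBogartVelasco2017_thm_1_8_holds :
    alperBogartVelasco2017_thm_1_8 :=
  fun K _ _ => determinantalComplexity_abvCubic (K := K)

end AlperBogartVelasco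

end Literature.Computability.AlgebraicComplexity
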